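import Literature.Geometry.Lorentzian.KerrTrappingMultipliers
import Literature.Geometry.Lorentzian.KerrTrappingRangeStructure
import HarnessLib

/-!
# The trapping estimate (Dafermos–Rodnianski–Shlapentokh-Rothman, Prop. 8.6.1)

(family `gr`, infrastructure for statement **gr.S24**; namespace `Literature.Geometry.Lorentzian.Kerr`)

Dafermos–Rodnianski–Shlapentokh-Rothman (*Decay for solutions of the wave equation on Kerr exterior
spacetimes III*, arXiv:1402.7034 = Ann. of Math. 183 (2016)), Prop. 8.6.1: in the trapping range
`(ω, m, Λ) ∈ 𝓖_♮(ω_high, ε_width)` ("`ω²` comparable to `Λ`", non-superradiant), for `ω_high`,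
`R_∞`, `E` sufficiently big depending on `ε_width`, "there exist functions `f` and `ŷ` and a value
`r_trap` satisfying the uniform bounds `r_trap = 0` or `0 < b < r_trap − r₊ < B`,
`|f| + Δ⁻¹r²|f'| + |ŷ| ≤ B(ε_width)`, `f = 1, ŷ = 0` for `r* ≥ R*_∞`, such that, for all smooth
solutions `u` to the radial o.d.e. with right hand side `H`, satisfying the boundary conditions
(eq:b−), (eq:b+),
`b ∫_{R*₋}^{R*₊} (|u'|² + ((ω² + Λ)(1 − r⁻¹r_trap)² + 1)|u|²)`
`  ≤ ∫ (−2f Re(u'H̄) − f' Re(uH̄) + Eω Im(Hū)) + ∫ 2ŷ Re(u'H̄)`" (thisisspartaEst).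

This file **proves** the proposition (`trapping_estimate_of_isFreqNatural'`) for fixed `0 < M`,
`0 ≤ a < M`, the repaired strip of `KerrFrequencyRanges.lean`, a tortoise radius function `R`
(`x = r*`, `KerrTortoiseRadius.lean`) and a region `[x₁, x₂]` with `R(x₁ − 1) ≥ r₊ + δ₀`,
`R(x₂ + 1) ≤ R_b` (the source's fixed `[R*₋, R*₊]`; here `δ₀ > 0`, `R_b ≥ 7M` are parameters on
which the constants depend), with **explicit multipliers** (`KerrTrappingMultipliers.lean`:
`f = A₀ + A₁Φ((x − c)/L)/I` the clipped-linear `r*`-profile, `ŷ = Y ∘ R` the horizon weight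
`Y = 1 − e^{Cψ}`) and the printed right-hand side in the form
`∫ combinedSource ω ϖ E μ u u' H` of `KerrCombinedCurrent.lean` (`ϖ = ω − ω₊m`; the sign of the
`ŷ`-term is that of the `ϟ`-identity of §7, as in Theorem 8.1's `H·(f, h, y, χ)·(u, u')`). The
proof follows the printed one:

* **Lemma 8.6.1** in the dichotomy form of `KerrTrappingRangeStructure.lean` (`r₃ = ∞`, or
  `r₃ ∈ [r₊ + d, 6M]`, `r_max ∈ [r₃ + d, 7M)` with the sign and non-degeneracy structure of `dV/dr`);
* case `r₃ < ∞` (`r_trap = r_max`): the current `Q = Q^f + ϟ^ŷ − EQ^T` with `f` linear in `r*` on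
  `|r* − c| ≤ L`, `c = r*(r_max)` ("`f` switches from negative to positive at `r = r_max`"; `L` so
  large that the region and the structured zone `r₃ ≤ r ≤ R_b` lie in the linear zone, where
  `f''' = 0`), `ŷ = Y_{C, r₃, θ} ∘ R` ("`ŷ' > 0` for `r ≤ r₃` … `dŷ/dr ≥ −ŷC + C`", here with
  equality, `KerrTrappingMultipliers.trapWeightDeriv_of_le`), `C` large, `θ` small, `Λ` large:
  `trapBulk_fin_bounds` verifies "the expression `−(fV' + ½f''')` is positive on `[r₃, ∞)`" and the
  absorption on `(r₊, r₃]` pointwise (bulk `≥ 0` on `ℝ`, and `≥ β(|u'|² + Λ(r* − c)²|u|²)` on the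
  region), and `trapping_estimate_fin` deduces (thisisspartaEst) from
  `KerrCombinedCurrent.combined_estimate_of_boundary_sign` ("for all `E` such that `C ≪ E`, the
  non-superradiant condition … and the boundary condition `u' = iωu` at `r = ∞` ensure that both
  boundary terms … are positive") and the concentration inequality of
  `KerrTrappingMultipliers.lean` (the `+1·|u|²` near `r_trap`);
* case `r₃ = ∞` (`r_trap = 0`): `trapping_estimate_inf`, the second construction of loc. cit.
  (`f` a step from `0` to `1` placed beyond the region, `ŷ` carrying the whole estimate), needed here
  only for `r₃ = ∞` since the finite `r₃` of Lemma 8.6.1 is `≤ 6M < R_dec = 7M`;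
* the size of `E` from the quantitative non-superradiance `(ω − ω₊m)² ≤ (1 + ω₊/√ε)²ω(ω − ω₊m)`
  in `𝓖_♮` (`sq_sub_le_mul_of_isFreqNatural'`), and "`ω_high` sufficiently large" as
  `Λ ≥ εω² ≥ εω²_high`.

Not transcribed: the uniformity in `a ∈ [0, a₀]`, and the specific `R*_∞`-behaviour
"`f = 1, ŷ = 0` for `r* ≥ R*_∞`" of Theorem 8.1 (here `f → A₀ + A₁`, `ŷ = 0` beyond `ρ + θ`, and the
region is a parameter). No named facts (D-0026); everything is proved, with explicit constants.

## References

* M. Dafermos, I. Rodnianski, Y. Shlapentokh-Rothman, arXiv:1402.7034 = Ann. of Math. 183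
  (2016), §8.6, Prop. 8.6.1 and its proof; §8.2 (key `DafermosRodnianskiShlapentokhrothman2014`).
-/

noncomputable section

open Set Filter Topology MeasureTheory
open scoped InnerProductSpace ComplexConjugate

namespace Literature.Geometry.Lorentzian

namespace Kerr

/-! ### Uniform bounds for `dV/dr` and `V` (`Λ ≥ 1`) -/

/-- **`|dV/dr| ≤ 208Λ/M³`** on `r ≥ r₊` for an admissible triple with `Λ ≥ 1` (`0 < M`, `|a| ≤ M`):
from `|dV/dr| ≤ 24Λ/r³ + 184M/r⁴` and `r ≥ M`. The bound "`|V'| ≤ B(ε_width)ΛΔ/r²`" of DRSR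
arXiv:1402.7034, proof of Prop. 8.6.1, for the `r`-derivative.
[cite: DafermosRodnianskiShlapentokhrothman2014, Prop. 8.6.1 (proof)] -/
theorem abs_deriv_sepPotential_le_of_one_le {M a ω Λ r : ℝ} {m : ℤ} (hM : 0 < M) (haM : |a| ≤ M)
    (hadm : IsAdmissibleTriple a ω m Λ) (hΛ : 1 ≤ Λ) (hr : rPlus M a ≤ r) :
    |deriv (sepPotential M a ω m Λ) r| ≤ 208 * Λ / M ^ 3 := by
  have hrM : M ≤ r := (M_le_rPlus M a).trans hr
  have hr0 : 0 < r := hM.trans_le hrM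
  have h := abs_deriv_sepPotential_le hM haM hadm hr
  have h1 : 24 * Λ / r ^ 3 ≤ 24 * Λ / M ^ 3 := by
    apply div_le_div_of_nonneg_left (by nlinarith) (by positivity)
    exact pow_le_pow_left₀ hM.le hrM 3
  have h2 : 184 * M / r ^ 4 ≤ 184 * Λ / M ^ 3 := by
    have h3 : 184 * M / r ^ 4 ≤ 184 * M / M ^ 4 := by
      apply div_le_div_of_nonneg_left (by positivity) (by positivity)
      exact pow_le_pow_left₀ hM.le hrM 4
    have h4 : 184 * M / M ^ 4 = 184 * 1 / M ^ 3 := by field_simp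
    have h5 : 184 * 1 / M ^ 3 ≤ 184 * Λ / M ^ 3 := by
      apply div_le_div_of_nonneg_right _ (by positivity); linarith
    linarith
  have e : 208 * Λ / M ^ 3 = 24 * Λ / M ^ 3 + 184 * Λ / M ^ 3 := by ring
  linarith

/-- **`V` is `208Λ/M³`-Lipschitz on `[r₊, ∞)`** (`Λ ≥ 1`).
[cite: DafermosRodnianskiShlapentokhrothman2014, Prop. 8.6.1 (proof)] -/
theorem abs_sepPotential_sub_le_of_one_le {M a ω Λ : ℝ} {m : ℤ} (hM : 0 < M) (haM : |a| ≤ M)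
    (hadm : IsAdmissibleTriple a ω m Λ) (hΛ : 1 ≤ Λ) {s r : ℝ} (hs : rPlus M a ≤ s)
    (hr : rPlus M a ≤ r) :
    |sepPotential M a ω m Λ r - sepPotential M a ω m Λ s| ≤ 208 * Λ / M ^ 3 * |r - s| := by
  have hrp0 : 0 < rPlus M a := hM.trans_le (M_le_rPlus M a)
  have h := Convex.norm_image_sub_le_of_norm_deriv_le (f := sepPotential M a ω m Λ)
    (fun z hz ↦ (hasDerivAt_sepPotential M a ω m Λ (by
      have : (0 : ℝ) < z := hrp0.trans_le hz
      positivity : z ^ 2 + a ^ 2 ≠ 0)).differentiableAt)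
    (fun z hz ↦ by
      rw [Real.norm_eq_abs]
      exact abs_deriv_sepPotential_le_of_one_le hM haM hadm hΛ hz)
    (convex_Ici (rPlus M a)) hs hr
  rwa [Real.norm_eq_abs, Real.norm_eq_abs] at h

/-! ### The bulk of the `𝓖_♮` current in the case `r₃ < ∞`: pointwise bounds -/

section FinBulk

variable {M a ω Λ E r₃ rmax bV d δ₀ Rb c X₁ X₂ L C θ D q₁ qlow : ℝ} {m : ℤ} {R : ℝ → ℝ}
  {u u₁ : ℝ → ℂ}

set_option maxHeartbeats 1600000 in
/-- **Pointwise bounds for the bulk of `Q = Q^f + ϟ^ŷ − EQ^T` in the trapping regime, case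
`r₃ < ∞`.** Hypotheses: the structure of `V` from Lemma 8.6.1 (`KerrTrappingRangeStructure.lean`):
`V ≤ ω² − b_VΛ` on `[r₊, r₃]`, `dV/dr > 0` on `[r₃, r_max)`, `dV/dr < 0` beyond `r_max`,
`b_VΛ(r − r_max)²/r⁴ ≤ −(r − r_max)dV/dr` on `[r₃, ∞)`, `r₊ + d ≤ r₃`, `r₃ + d ≤ r_max < 7M`; a
tortoise radius function `R` with `R(c) = r_max`; a region `[X₁, X₂]` with `R(X₁) ≥ r₊ + δ₀`,
`R(X₂) ≤ R_b` (`R_b ≥ 7M`); and the multipliers `trapMultipliers M a c L 0 1 C r₃ θ R` with: `L`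
large (`L ≥ R_b/q₁ + 1`, `q₁ = q(r₊ + min(δ₀, d))`, so that the region and the whole structured zone
`r₃ ≤ R ≤ R_b` lie in the linear zone `|x − c| < L` of `f`), `C` large (`C ≥ 4B₁/b_V`,
`B₁ = 208/M³ ≥ |dV/dr|/Λ`, and `C ≥ 4/(L I R_b²)`), `θ` small (`0 < θ ≤ d/2`, `θ ≤ b_V/(2B₁)`), and
`Λ` large (the two displayed conditions, absorbing `½|f'''| ≤ D/(2L³I)` on the two transition
zones of `f`: towards the horizon `q ≥ q_low = q(r₊ + 2de^{−2L/M})` by the exponential depth bound,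
towards infinity `r − r_max ≥ q₁L`). Conclusions: the bulk is non-negative on `ℝ`, and on `[X₁, X₂]`
it dominates `β(|u'|² + Λ(x − c)²|u|²)`, `β = min(2/(LI), q₁³b_V/(LIR_b⁴))` (`I = sharpBumpMass`).
This is the verification "By the described properties of the potential `V`, the expression
`−(fV' + ½f''')` is positive on `[r₃, ∞)` … on `(r₊, r₃]` … it suffices to fulfil `dŷ/dr ≥ −ŷC + C`"
of DRSR arXiv:1402.7034, proof of Prop. 8.6.1, for the explicit profiles of
`KerrTrappingMultipliers.lean`.
[cite: DafermosRodnianskiShlapentokhrothman2014, Prop. 8.6.1 (proof)] -/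
theorem trapBulk_fin_bounds (hMa : IsSubextremal M a) (hR : IsTortoiseRadius M a R)
    (hadm : IsAdmissibleTriple a ω m Λ) (hΛ1 : 1 ≤ Λ) (hbV : 0 < bV) (hd : 0 < d) (hδ₀ : 0 < δ₀)
    (hr₃ : rPlus M a + d ≤ r₃) (hgap : r₃ + d ≤ rmax) (h7 : rmax < 7 * M)
    (hS2 : ∀ r ∈ Icc (rPlus M a) r₃, sepPotential M a ω m Λ r ≤ ω ^ 2 - bV * Λ)
    (hS3a : ∀ r ∈ Ico r₃ rmax, 0 < deriv (sepPotential M a ω m Λ) r)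
    (hS3b : ∀ r ∈ Ioi rmax, deriv (sepPotential M a ω m Λ) r < 0)
    (hS4 : ∀ r ∈ Ici r₃, bV * Λ * (r - rmax) ^ 2 / r ^ 4 ≤
      -((r - rmax) * deriv (sepPotential M a ω m Λ) r))
    (hc : R c = rmax) (hRb : 7 * M ≤ Rb) (hX₁ : rPlus M a + δ₀ ≤ R X₁) (hX₂ : R X₂ ≤ Rb)
    (hq₁ : q₁ = delta M a (rPlus M a + min δ₀ d) / ((rPlus M a + min δ₀ d) ^ 2 + a ^ 2))
    (hqlow : qlow = delta M a (rPlus M a + 2 * d * Real.exp (-(2 * L) / M)) /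
      ((rPlus M a + 2 * d * Real.exp (-(2 * L) / M)) ^ 2 + a ^ 2))
    (hD : ∀ t, |sharpBump₂ t| ≤ D) (hL : Rb / q₁ + 1 ≤ L)
    (hC : 4 * (208 / M ^ 3) / bV ≤ C) (hC' : 4 / (L * sharpBumpMass * Rb ^ 2) ≤ C)
    (hθ : 0 < θ) (hθd : θ ≤ d / 2) (hθB : θ * (208 / M ^ 3) ≤ bV / 2)
    (hΛA : D / (L ^ 3 * sharpBumpMass) ≤ C * bV / 4 * qlow * Λ)
    (hΛC : D / (L ^ 3 * sharpBumpMass) ≤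
      q₁ ^ 2 * bV * L * Λ / (sharpBumpMass * (7 * M + 2 * L) ^ 4)) :
    (∀ x, 0 ≤ combinedBulk ω (ω - horizonAngularVelocity M a * m) E
        (fun x ↦ sepPotential M a ω m Λ (R x))
        (fun x ↦ deriv (sepPotential M a ω m Λ) (R x) * (delta M a (R x) / (R x ^ 2 + a ^ 2)))
        (trapMultipliers M a c L 0 1 C r₃ θ R) u u₁ x) ∧
    (∀ x ∈ Icc X₁ X₂,
      min (2 / (L * sharpBumpMass)) (q₁ ^ 3 * bV / (L * sharpBumpMass * Rb ^ 4)) *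
          (‖u₁ x‖ ^ 2 + Λ * (x - c) ^ 2 * ‖u x‖ ^ 2) ≤
        combinedBulk ω (ω - horizonAngularVelocity M a * m) E
          (fun x ↦ sepPotential M a ω m Λ (R x))
          (fun x ↦ deriv (sepPotential M a ω m Λ) (R x) * (delta M a (R x) / (R x ^ 2 + a ^ 2)))
          (trapMultipliers M a c L 0 1 C r₃ θ R) u u₁ x) := by
  /- ─────────────── basic constants ─────────────── -/
  have hM := hMa.pos
  have haM : |a| ≤ M := le_of_lt hMa
  have hrpM : M ≤ rPlus M a := M_le_rPlus M a
  have hrp0 : 0 < rPlus M a := hM.trans_le hrpM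
  have hΛ0 : 0 < Λ := one_pos.trans_le hΛ1
  -- `I = sharpBumpMass`, made opaque
  obtain ⟨I, hIdef⟩ : ∃ I : ℝ, I = sharpBumpMass := ⟨_, rfl⟩
  simp only [← hIdef] at hC' hΛA hΛC ⊢
  have hI1 : 1 ≤ I := by rw [hIdef]; exact sharpBumpMass_mem_Icc.1
  have hI0 : 0 < I := by rw [hIdef]; exact sharpBumpMass_pos
  -- `B₁ = 208/M³`
  obtain ⟨B₁, hB₁⟩ : ∃ B₁ : ℝ, B₁ = 208 / M ^ 3 := ⟨_, rfl⟩
  rw [← hB₁] at hC hθB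
  have hB₁0 : 0 < B₁ := by rw [hB₁]; positivity
  have hC0 : 0 < C := lt_of_lt_of_le (by positivity) hC
  have hCB : 4 * B₁ ≤ C * bV := by
    rw [div_le_iff₀ hbV] at hC; linarith
  have hRb0 : 0 < Rb := by linarith
  have hRbM : M ≤ Rb := by linarith
  -- `q = Δ/(r² + a²)`, opaque
  obtain ⟨q, hqdef⟩ : ∃ q : ℝ → ℝ, ∀ r, q r = delta M a r / (r ^ 2 + a ^ 2) := ⟨_, fun _ ↦ rfl⟩
  have hq_pos : ∀ r, rPlus M a < r → 0 < q r := fun r hr ↦ by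
    rw [hqdef]; exact div_pos (Kerr.delta_pos haM hr) (by have := hrp0.trans hr; positivity)
  have hq_mono : ∀ s r, rPlus M a ≤ s → s ≤ r → q s ≤ q r := fun s r hs hsr ↦ by
    rw [hqdef, hqdef]
    exact delta_div_mono hM.le (hrp0.trans_le hs) (haM.trans (hrpM.trans hs)) hsr
  have hq_le_one : ∀ x, q (R x) ≤ 1 := fun x ↦ by rw [hqdef]; exact hR.deriv_le_one hMa x
  have hqR_pos : ∀ x, 0 < q (R x) := fun x ↦ hq_pos _ (hR.rPlus_lt x)
  have hRq_le : ∀ x y, x ≤ y → q (R x) * (y - x) ≤ R y - R x := fun x y hxy ↦ by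
    rw [hqdef]; exact hR.mul_sub_le hMa hxy
  -- `q₁ > 0`, `qlow > 0`
  obtain ⟨δ₁, hδ₁⟩ : ∃ δ₁ : ℝ, δ₁ = min δ₀ d := ⟨_, rfl⟩
  have hδ₁0 : 0 < δ₁ := by rw [hδ₁]; exact lt_min hδ₀ hd
  have hδ₁δ₀ : δ₁ ≤ δ₀ := by rw [hδ₁]; exact min_le_left _ _
  have hδ₁d : δ₁ ≤ d := by rw [hδ₁]; exact min_le_right _ _
  have hq₁' : q₁ = q (rPlus M a + δ₁) := by rw [hq₁, hqdef, hδ₁]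
  have hq₁0 : 0 < q₁ := by rw [hq₁']; exact hq_pos _ (by linarith)
  obtain ⟨rlow, hrlow⟩ : ∃ rlow : ℝ, rlow = rPlus M a + 2 * d * Real.exp (-(2 * L) / M) := ⟨_, rfl⟩
  have hqlow' : qlow = q rlow := by rw [hqlow, hqdef, hrlow]
  have hrlow_gt : rPlus M a < rlow := by
    have := Real.exp_pos (-(2 * L) / M); rw [hrlow]; nlinarith
  have hqlow0 : 0 < qlow := by rw [hqlow']; exact hq_pos _ hrlow_gt
  have hL1 : 1 ≤ L := by
    have : 0 ≤ Rb / q₁ := div_nonneg hRb0.le hq₁0.le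
    linarith
  have hL0 : 0 < L := one_pos.trans_le hL1
  have hC'' : 4 ≤ C * (L * I * Rb ^ 2) := (div_le_iff₀ (by positivity)).1 hC'
  have hrlow_le : ∀ x, c - 2 * L ≤ x → x ≤ c → rlow ≤ R x := by
    intro x h1 h2
    have h := hR.sub_rPlus_ge hMa h2
    rw [hc] at h
    have h3 : 2 * d * Real.exp (-(2 * L) / M) ≤ (rmax - rPlus M a) * Real.exp (-(c - x) / M) := by
      have e1 : Real.exp (-(2 * L) / M) ≤ Real.exp (-(c - x) / M) := by
        rw [Real.exp_le_exp, div_le_div_iff_of_pos_right hM]; linarith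
      have e2 : 2 * d ≤ rmax - rPlus M a := by linarith
      exact mul_le_mul e2 e1 (Real.exp_pos _).le (by linarith)
    rw [hrlow]; linarith
  have hLq : Rb / q₁ < L := by linarith
  clear hq₁ hqlow hrlow hδ₁ hL
  /- ─────────────── the potential ─────────────── -/
  obtain ⟨Vf, hVfdef⟩ : ∃ Vf : ℝ → ℝ, ∀ r, Vf r = sepPotential M a ω m Λ r := ⟨_, fun _ ↦ rfl⟩
  obtain ⟨Vr, hVrdef⟩ : ∃ Vr : ℝ → ℝ, ∀ r, Vr r = deriv (sepPotential M a ω m Λ) r :=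
    ⟨_, fun _ ↦ rfl⟩
  have hS2' : ∀ r, rPlus M a ≤ r → r ≤ r₃ → Vf r ≤ ω ^ 2 - bV * Λ := fun r h1 h2 ↦ by
    rw [hVfdef]; exact hS2 r ⟨h1, h2⟩
  have hS3a' : ∀ r, r₃ ≤ r → r < rmax → 0 < Vr r := fun r h1 h2 ↦ by
    rw [hVrdef]; exact hS3a r ⟨h1, h2⟩
  have hS3b' : ∀ r, rmax < r → Vr r < 0 := fun r h ↦ by rw [hVrdef]; exact hS3b r h
  have hS4' : ∀ r, r₃ ≤ r → bV * Λ * (r - rmax) ^ 2 / r ^ 4 ≤ -((r - rmax) * Vr r) :=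
    fun r h ↦ by rw [hVrdef]; exact hS4 r h
  have hVr_abs : ∀ r, rPlus M a ≤ r → |Vr r| ≤ B₁ * Λ := fun r hr ↦ by
    have h := abs_deriv_sepPotential_le_of_one_le (ω := ω) (m := m) hM haM hadm hΛ1 hr
    rw [hVrdef, hB₁]; convert h using 1; ring
  have hVlip : ∀ s r, rPlus M a ≤ s → rPlus M a ≤ r → |Vf r - Vf s| ≤ B₁ * Λ * |r - s| :=
    fun s r hs hr ↦ by
    have h := abs_sepPotential_sub_le_of_one_le (ω := ω) (m := m) hM haM hadm hΛ1 hs hr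
    rw [hVfdef, hVfdef, hB₁]; convert h using 1; ring
  clear hB₁
  /- ─────────────── geometry along `R` ─────────────── -/
  have hRgt : ∀ x, rPlus M a < R x := hR.rPlus_lt
  have hRmono := (hR.strictMono hMa).monotone
  have hr₃p : rPlus M a < r₃ := by linarith
  have hrmaxp : rPlus M a < rmax := by linarith
  -- `q(R(min x c)) ≥ q₁` when `R x ≥ r₊ + δ₁`
  have hqmin : ∀ x, rPlus M a + δ₁ ≤ R x → q₁ ≤ q (R (min x c)) := by
    intro x hx
    rw [hq₁']
    apply hq_mono _ _ (by linarith)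
    rcases le_total x c with h | h
    · rw [min_eq_left h]; exact hx
    · rw [min_eq_right h, hc]; linarith
  -- `q₁ |x − c| ≤ |R x − r_max|` for such `x`
  have hdist : ∀ x, rPlus M a + δ₁ ≤ R x → q₁ * |x - c| ≤ |R x - rmax| := by
    intro x hx
    have hq := hqmin x hx
    rcases le_total x c with h | h
    · have h1 : q (R x) * (c - x) ≤ R c - R x := hRq_le x c h
      rw [min_eq_left h] at hq
      have hRle : R x ≤ rmax := by rw [← hc]; exact hRmono h
      rw [abs_of_nonpos (sub_nonpos.2 h), abs_of_nonpos (sub_nonpos.2 hRle)]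
      have h2 : q₁ * (c - x) ≤ q (R x) * (c - x) := mul_le_mul_of_nonneg_right hq (by linarith)
      rw [hc] at h1
      linarith
    · have h1 : q (R c) * (x - c) ≤ R x - R c := hRq_le c x h
      rw [min_eq_right h] at hq
      have hRge : rmax ≤ R x := by rw [← hc]; exact hRmono h
      rw [abs_of_nonneg (sub_nonneg.2 h), abs_of_nonneg (sub_nonneg.2 hRge)]
      have h2 : q₁ * (x - c) ≤ q (R c) * (x - c) := mul_le_mul_of_nonneg_right hq (by linarith)
      have h3 : R x - R c = R x - rmax := by rw [hc]
      linarith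
  -- the linear zone contains the region and the structured zone
  have hzone : ∀ x, rPlus M a + δ₁ ≤ R x → R x ≤ Rb → |x - c| < L := by
    intro x hx hxb
    have h1 := hdist x hx
    have h2 : |R x - rmax| < Rb := by
      rw [abs_lt]; constructor <;> linarith [hRgt x, hrp0, h7, hRb, hxb, hrmaxp]
    have h3 : |x - c| < Rb / q₁ := by
      rw [lt_div_iff₀ hq₁0]
      have e := mul_comm q₁ |x - c|
      linarith
    linarith [hLq]
  have hzoneX : ∀ x ∈ Icc X₁ X₂, |x - c| < L := fun x hx ↦
    hzone x (by have := hRmono hx.1; linarith) ((hRmono hx.2).trans hX₂)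
  have hzone₃ : ∀ x, r₃ ≤ R x → R x ≤ Rb → |x - c| < L := fun x hx hxb ↦
    hzone x (by linarith) hxb
  -- depth bound on `[c − 2L, c]`
  have hdepth : ∀ x, c - 2 * L ≤ x → x ≤ c → qlow ≤ q (R x) := by
    intro x h1 h2
    rw [hqlow']
    exact hq_mono _ _ hrlow_gt.le (hrlow_le x h1 h2)
  /- ─────────────── the profile `f` (opaque copies of the fields) ─────────────── -/
  obtain ⟨fs, hfsdef⟩ : ∃ fs : ℝ → ℝ, ∀ x, fs x = (sharpMultipliers c L 1 0).f x :=
    ⟨_, fun _ ↦ rfl⟩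
  obtain ⟨fs1, hfs1def⟩ : ∃ fs1 : ℝ → ℝ, ∀ x, fs1 x = (sharpMultipliers c L 1 0).f' x :=
    ⟨_, fun _ ↦ rfl⟩
  obtain ⟨fs3, hfs3def⟩ : ∃ fs3 : ℝ → ℝ, ∀ x, fs3 x = (sharpMultipliers c L 1 0).f''' x :=
    ⟨_, fun _ ↦ rfl⟩
  have hf_abs : ∀ x, |fs x| ≤ 1 := fun x ↦ by
    rw [hfsdef]; exact sharpMultipliers_abs_f_le_one c L 1 0 x
  have hf_lin : ∀ x, |x - c| ≤ L → fs x = (x - c) / (L * I) := fun x hx ↦ by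
    rw [hfsdef, hIdef]; exact sharpMultipliers_f_eq_div (d := 1) (A := 0) hL0 hx
  have hf_one : ∀ x, c + 2 * L ≤ x → fs x = 1 := fun x hx ↦ by
    rw [hfsdef]; exact sharpMultipliers_f_eq_one (d := 1) (A := 0) hL0 hx
  have hf_ge : ∀ x, c + L ≤ x → 1 / I ≤ fs x := fun x hx ↦ by
    rw [hfsdef, hIdef]; exact sharpMultipliers_inv_le_f (d := 1) (A := 0) hL0 hx
  have hf'_nonneg : ∀ x, 0 ≤ fs1 x := fun x ↦ by
    rw [hfs1def]; exact sharpMultipliers_f'_nonneg (d := 1) (A := 0) hL0 x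
  have hf'_lin : ∀ x, |x - c| ≤ L → fs1 x = 1 / (L * I) := fun x hx ↦ by
    rw [hfs1def, hIdef]; exact sharpMultipliers_f'_eq (d := 1) (A := 0) hL0 hx
  have hf'''_abs : ∀ x, |fs3 x| ≤ D / (L ^ 3 * I) := fun x ↦ by
    rw [hfs3def, hIdef]; exact sharpMultipliers_abs_f'''_le (d := 1) (A := 0) hL0 hD x
  have hf'''_lt : ∀ x, |x - c| < L → fs3 x = 0 := fun x hx ↦ by
    rw [hfs3def]; exact sharpMultipliers_f'''_eq_zero_of_lt (d := 1) (A := 0) hL0 hx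
  have hf'''_gt : ∀ x, 2 * L < |x - c| → fs3 x = 0 := fun x hx ↦ by
    rw [hfs3def]; exact sharpMultipliers_f'''_eq_zero_of_gt (d := 1) (A := 0) hL0 hx
  have hdiv2 : D / (2 * (L ^ 3 * I)) = D / (L ^ 3 * I) / 2 := by ring
  have hf'''_half : ∀ x, 1 / 2 * |fs3 x| ≤ D / (2 * (L ^ 3 * I)) := fun x ↦ by
    have := hf'''_abs x
    rw [hdiv2]
    linarith
  clear hIdef
  /- ─────────────── the weight `Y` ─────────────── -/
  obtain ⟨Y, hYdef⟩ : ∃ Y : ℝ → ℝ, ∀ r, Y r = trapWeight C r₃ θ r := ⟨_, fun _ ↦ rfl⟩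
  obtain ⟨Y', hY'def⟩ : ∃ Y' : ℝ → ℝ, ∀ r, Y' r = trapWeightDeriv C r₃ θ r := ⟨_, fun _ ↦ rfl⟩
  have hY_nonpos : ∀ r, Y r ≤ 0 := fun r ↦ by rw [hYdef]; exact trapWeight_nonpos hC0.le hθ r₃ r
  have hY'_nonneg : ∀ r, 0 ≤ Y' r := fun r ↦ by
    rw [hY'def]; exact trapWeightDeriv_nonneg hC0.le hθ r₃ r
  have hY'_eq : ∀ r, r ≤ r₃ → Y' r = C * (1 - Y r) := fun r hr ↦ by
    rw [hY'def, hYdef]; exact trapWeightDeriv_of_le hθ hr C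
  have hY_zero : ∀ r, r₃ + θ ≤ r → Y r = 0 := fun r hr ↦ by
    rw [hYdef]; exact trapWeight_of_ge hr hθ.le C
  have hY'_zero : ∀ r, r₃ + θ ≤ r → Y' r = 0 := fun r hr ↦ by
    rw [hY'def]; exact trapWeightDeriv_of_ge hr hθ.le C
  /- ─────────────── the bulk, factorised ─────────────── -/
  obtain ⟨W, hW⟩ : ∃ W : ℝ → ℝ, ∀ x, W x = -(fs x * (Vr (R x) * q (R x))) - 1 / 2 * fs3 x +
      Y' (R x) * q (R x) * (ω ^ 2 - Vf (R x)) - Y (R x) * (Vr (R x) * q (R x)) :=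
    ⟨_, fun _ ↦ rfl⟩
  obtain ⟨P, hP⟩ : ∃ P : ℝ → ℝ, ∀ x, P x = 2 * fs1 x + Y' (R x) * q (R x) := ⟨_, fun _ ↦ rfl⟩
  have hbulk : ∀ x, combinedBulk ω (ω - horizonAngularVelocity M a * m) E
      (fun x ↦ sepPotential M a ω m Λ (R x))
      (fun x ↦ deriv (sepPotential M a ω m Λ) (R x) * (delta M a (R x) / (R x ^ 2 + a ^ 2)))
      (trapMultipliers M a c L 0 1 C r₃ θ R) u u₁ x = P x * ‖u₁ x‖ ^ 2 + W x * ‖u x‖ ^ 2 := by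
    intro x
    rw [combinedBulk_trapMultipliers, hP, hW, hfsdef, hfs1def, hfs3def, hYdef, hY'def, hVfdef,
      hVrdef, hqdef, (trapMultipliers_f M a c L 0 1 C r₃ θ R x).1,
      (trapMultipliers_f M a c L 0 1 C r₃ θ R x).2.1,
      (trapMultipliers_f M a c L 0 1 C r₃ θ R x).2.2.2,
      trapMultipliers_y']
    ring
  have hP_nonneg : ∀ x, 0 ≤ P x := fun x ↦ by
    rw [hP]
    have := hf'_nonneg x
    have := mul_nonneg (hY'_nonneg (R x)) (hqR_pos x).le
    linarith
  have hP_lin : ∀ x, |x - c| ≤ L → 2 / (L * I) ≤ P x := fun x hx ↦ by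
    rw [hP, hf'_lin x hx]
    have := mul_nonneg (hY'_nonneg (R x)) (hqR_pos x).le
    have e : 2 / (L * I) = 2 * (1 / (L * I)) := by ring
    linarith
  /- ─────────────── region A: `R x ≤ r₃` ─────────────── -/
  have hA : ∀ x, R x ≤ r₃ → C * bV / 4 * q (R x) * Λ ≤ W x := by
    intro x hx
    have hrp : rPlus M a ≤ R x := (hRgt x).le
    have hq0 := hqR_pos x
    obtain ⟨G, hG⟩ : ∃ G : ℝ, G = 1 - Y (R x) := ⟨_, rfl⟩
    have hYx := hY_nonpos (R x)
    have hG1 : 1 ≤ G := by rw [hG]; linarith only [hYx]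
    have hYabs : |Y (R x)| ≤ G := by
      rw [abs_of_nonpos hYx, hG]; linarith only [hYx]
    have hY'r : Y' (R x) = C * G := by rw [hG]; exact hY'_eq (R x) hx
    have hV2 : bV * Λ ≤ ω ^ 2 - Vf (R x) := by
      have := hS2' (R x) hrp hx; linarith only [this]
    have hVr' : |Vr (R x)| ≤ B₁ * Λ := hVr_abs (R x) hrp
    -- the three `q`-terms
    have t1 : C * G * q (R x) * (bV * Λ) ≤ Y' (R x) * q (R x) * (ω ^ 2 - Vf (R x)) := by
      rw [hY'r]
      exact mul_le_mul_of_nonneg_left hV2 (by positivity)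
    have t2 : fs x * (Vr (R x) * q (R x)) ≤ q (R x) * (B₁ * Λ) := by
      have h1 : |fs x * (Vr (R x) * q (R x))| ≤ 1 * (B₁ * Λ * q (R x)) := by
        rw [abs_mul]
        refine mul_le_mul (hf_abs x) ?_ (abs_nonneg _) zero_le_one
        rw [abs_mul, abs_of_pos hq0]
        exact mul_le_mul_of_nonneg_right hVr' hq0.le
      have h2 := le_abs_self (fs x * (Vr (R x) * q (R x)))
      have e : 1 * (B₁ * Λ * q (R x)) = q (R x) * (B₁ * Λ) := by ring
      linarith only [h1, h2, e]
    have t3 : Y (R x) * (Vr (R x) * q (R x)) ≤ G * (B₁ * Λ) * q (R x) := by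
      have h1 : |Y (R x) * (Vr (R x) * q (R x))| ≤ G * (B₁ * Λ * q (R x)) := by
        rw [abs_mul]
        refine mul_le_mul hYabs ?_ (abs_nonneg _) (by linarith only [hG1])
        rw [abs_mul, abs_of_pos hq0]
        exact mul_le_mul_of_nonneg_right hVr' hq0.le
      have h2 := le_abs_self (Y (R x) * (Vr (R x) * q (R x)))
      have e : G * (B₁ * Λ * q (R x)) = G * (B₁ * Λ) * q (R x) := by ring
      linarith only [h1, h2, e]
    -- `½|f'''|`: either `0` or absorbed by `Λ` (depth bound)
    have t4 : 1 / 2 * fs3 x ≤ C * bV / 8 * q (R x) * Λ := by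
      by_cases hz : fs3 x = 0
      · rw [hz, mul_zero]; positivity
      · -- `L ≤ |x − c| ≤ 2L` and `x < c`
        have hxc : x < c := by
          by_contra h; push Not at h
          have : rmax ≤ R x := by rw [← hc]; exact hRmono h
          linarith only [this, hx, hgap, hd]
        have h1 : L ≤ |x - c| := by
          by_contra h; push Not at h; exact hz (hf'''_lt x h)
        have h2 : |x - c| ≤ 2 * L := by
          by_contra h; push Not at h; exact hz (hf'''_gt x h)
        rw [abs_of_neg (sub_neg.2 hxc)] at h1 h2
        have hx2 : c - 2 * L ≤ x := by linarith only [h2]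
        have hql : qlow ≤ q (R x) := hdepth x hx2 hxc.le
        have h3 := hf'''_half x
        have h4 : D / (2 * (L ^ 3 * I)) ≤ C * bV / 8 * qlow * Λ := by
          rw [hdiv2]; linarith only [hΛA]
        have h5 : C * bV / 8 * qlow * Λ ≤ C * bV / 8 * q (R x) * Λ := by
          apply mul_le_mul_of_nonneg_right _ hΛ0.le
          exact mul_le_mul_of_nonneg_left hql (by positivity)
        linarith only [h3, h4, h5, le_abs_self (fs3 x)]
    have key : C * bV / 4 * q (R x) * Λ ≤
        C * G * q (R x) * (bV * Λ) - q (R x) * (B₁ * Λ) - G * (B₁ * Λ) * q (R x) -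
          C * bV / 8 * q (R x) * Λ := by
      -- `C b_V G − B₁ − G B₁ − C b_V/8 ≥ C b_V/4` using `G ≥ 1`, `4B₁ ≤ C b_V`
      have hT : 0 ≤ q (R x) * Λ := by positivity
      have hCbV : 0 ≤ C * bV := by positivity
      have f0 : 0 ≤ C * bV * (q (R x) * Λ) := mul_nonneg hCbV hT
      have f1 : C * bV * (q (R x) * Λ) ≤ C * bV * G * (q (R x) * Λ) := by
        apply mul_le_mul_of_nonneg_right _ hT
        have := mul_le_mul_of_nonneg_left hG1 hCbV
        linarith only [this]
      have f2 : B₁ * (q (R x) * Λ) ≤ C * bV / 4 * (q (R x) * Λ) :=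
        mul_le_mul_of_nonneg_right (by linarith only [hCB]) hT
      have f3 : G * B₁ * (q (R x) * Λ) ≤ C * bV * G / 4 * (q (R x) * Λ) := by
        apply mul_le_mul_of_nonneg_right _ hT
        have hG0 : 0 ≤ G := by linarith only [hG1]
        have := mul_le_mul_of_nonneg_right hCB hG0
        linarith only [this]
      linarith only [f0, f1, f2, f3]
    rewrite [hW]
    linarith only [t1, t2, t3, t4, key]
  /- ─────────────── region B: `r₃ < R x ≤ r₃ + θ` ─────────────── -/
  have hB : ∀ x, r₃ < R x → R x ≤ r₃ + θ →
      q (R x) * (c - x) / (L * I) * Vr (R x) ≤ W x ∧ x < c ∧ 0 < Vr (R x) ∧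
        bV * Λ * (rmax - R x) / (R x) ^ 4 ≤ Vr (R x) := by
    intro x h1 h2
    have hq0 := hqR_pos x
    have hr0 : 0 < R x := hrp0.trans (hRgt x)
    have hrlt : R x < rmax := by linarith only [h2, hθd, hgap, hd]
    have hxc : x < c := by
      by_contra h; push Not at h
      have : rmax ≤ R x := by rw [← hc]; exact hRmono h
      linarith only [this, hrlt]
    have hVpos : 0 < Vr (R x) := hS3a' (R x) h1.le hrlt
    have hRxb : R x ≤ Rb := by linarith only [h2, hθd, hgap, h7, hRb, hd]
    have hlin : |x - c| < L := hzone₃ x h1.le hRxb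
    have hfx : fs x = (x - c) / (L * I) := hf_lin x hlin.le
    have hf3 : fs3 x = 0 := hf'''_lt x hlin
    -- `ω² − V ≥ 0` on `[r₃, r₃ + θ]`
    have hV2 : 0 ≤ ω ^ 2 - Vf (R x) := by
      have h3 := hS2' r₃ hr₃p.le le_rfl
      have h4 := hVlip r₃ (R x) hr₃p.le (hRgt x).le
      have hnn : 0 ≤ R x - r₃ := by linarith only [h1]
      rw [abs_of_nonneg hnn] at h4
      have hle : R x - r₃ ≤ θ := by linarith only [h2]
      have h5 : B₁ * Λ * (R x - r₃) ≤ B₁ * Λ * θ :=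
        mul_le_mul_of_nonneg_left hle (by positivity)
      have h6 : B₁ * Λ * θ ≤ bV / 2 * Λ := by
        have := mul_le_mul_of_nonneg_right hθB hΛ0.le
        linarith only [this]
      have hbΛ : 0 ≤ bV * Λ := by positivity
      linarith only [h3, h4, h5, h6, le_abs_self (Vf (R x) - Vf r₃), hbΛ]
    have hS4r : bV * Λ * (rmax - R x) / (R x) ^ 4 ≤ Vr (R x) := by
      have h := hS4' (R x) h1.le
      have hpos : 0 < rmax - R x := by linarith only [hrlt]
      have e : bV * Λ * (R x - rmax) ^ 2 / (R x) ^ 4 =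
          (rmax - R x) * (bV * Λ * (rmax - R x) / (R x) ^ 4) := by ring
      have e2 : -((R x - rmax) * Vr (R x)) = (rmax - R x) * Vr (R x) := by ring
      have h' : (rmax - R x) * (bV * Λ * (rmax - R x) / (R x) ^ 4) ≤ (rmax - R x) * Vr (R x) := by
        rw [← e, ← e2]; exact h
      exact le_of_mul_le_mul_left h' hpos
    refine ⟨?_, hxc, hVpos, hS4r⟩
    rewrite [hW, hfx, hf3]
    have t1 : 0 ≤ Y' (R x) * q (R x) * (ω ^ 2 - Vf (R x)) :=
      mul_nonneg (mul_nonneg (hY'_nonneg (R x)) hq0.le) hV2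
    have t2 : Y (R x) * (Vr (R x) * q (R x)) ≤ 0 :=
      mul_nonpos_of_nonpos_of_nonneg (hY_nonpos (R x)) (mul_pos hVpos hq0).le
    have e : -((x - c) / (L * I) * (Vr (R x) * q (R x))) =
        q (R x) * (c - x) / (L * I) * Vr (R x) := by ring
    linarith only [t1, t2, e]
  /- ─────────────── region C: `R x > r₃ + θ` ─────────────── -/
  have hC1 : ∀ x, r₃ + θ < R x → |x - c| < L →
      q (R x) / (L * I) * (bV * Λ * (R x - rmax) ^ 2 / (R x) ^ 4) ≤ W x := by
    intro x h1 hlin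
    have hq0 := hqR_pos x
    have hfx : fs x = (x - c) / (L * I) := hf_lin x hlin.le
    have hf3 : fs3 x = 0 := hf'''_lt x hlin
    have hYr : Y (R x) = 0 := hY_zero (R x) h1.le
    have hY'r : Y' (R x) = 0 := hY'_zero (R x) h1.le
    have hr₃r : r₃ ≤ R x := by linarith only [h1, hθ]
    -- `−(x − c) V_r ≥ −(R x − r_max) V_r ≥ b_VΛ(R x − r_max)²/r⁴`
    have hsign : -((R x - rmax) * Vr (R x)) ≤ -((x - c) * Vr (R x)) := by
      rcases lt_trichotomy x c with hxc | hxc | hxc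
      · -- `x < c`: `R x < r_max`, `dV/dr > 0`
        have hrlt : R x < rmax := by rw [← hc]; exact hR.strictMono hMa hxc
        have hVpos : 0 < Vr (R x) := hS3a' (R x) hr₃r hrlt
        have h2 : x - c ≤ R x - rmax := by
          have := hR.sub_le hMa hxc.le; rw [hc] at this; linarith only [this]
        have h3 := mul_le_mul_of_nonneg_right h2 hVpos.le
        linarith only [h3]
      · subst hxc
        rw [hc]; simp
      · -- `x > c`: `R x > r_max`, `dV/dr < 0`
        have hrgt : rmax < R x := by rw [← hc]; exact hR.strictMono hMa hxc
        have hVneg : Vr (R x) < 0 := hS3b' (R x) hrgt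
        have h2 : R x - rmax ≤ x - c := by
          have := hR.sub_le hMa hxc.le; rw [hc] at this; linarith only [this]
        have h3 := mul_le_mul_of_nonpos_right h2 hVneg.le
        linarith only [h3]
    have h4 := hS4' (R x) hr₃r
    rewrite [hW, hfx, hf3, hYr, hY'r]
    have e : -((x - c) / (L * I) * (Vr (R x) * q (R x))) =
        q (R x) / (L * I) * (-((x - c) * Vr (R x))) := by ring
    have h5 := mul_le_mul_of_nonneg_left (h4.trans hsign) (by positivity : 0 ≤ q (R x) / (L * I))
    linarith only [e, h5]
  have hC2 : ∀ x, r₃ + θ < R x → L ≤ x - c → x - c ≤ 2 * L → 0 ≤ W x := by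
    intro x h1 h2 h3
    have hq0 := hqR_pos x
    have hYr : Y (R x) = 0 := hY_zero (R x) h1.le
    have hY'r : Y' (R x) = 0 := hY'_zero (R x) h1.le
    have hxc : c < x := by linarith only [h2, hL0]
    have hrgt : rmax < R x := by rw [← hc]; exact hR.strictMono hMa hxc
    have hVneg : Vr (R x) < 0 := hS3b' (R x) hrgt
    have hxL : c + L ≤ x := by linarith only [h2]
    have hfge : 1 / I ≤ fs x := hf_ge x hxL
    have hr0 : 0 < R x := hrp0.trans (hRgt x)
    -- `R x − r_max ≥ q₁ L`, `R x ≤ 7M + 2L`, `q (R x) ≥ q₁`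
    have hδ₁p : rPlus M a ≤ rPlus M a + δ₁ := by linarith only [hδ₁0]
    have hqc : q₁ ≤ q (R c) := by
      have hle : rPlus M a + δ₁ ≤ rmax := by linarith only [hδ₁d, hr₃, hgap, hd]
      rw [hq₁', hc]
      exact hq_mono _ _ hδ₁p hle
    have hgapL : q₁ * L ≤ R x - rmax := by
      have h : q (R c) * (x - c) ≤ R x - R c := hRq_le c x hxc.le
      have hxc0 : 0 ≤ x - c := by linarith only [h2, hL0]
      have h' : q₁ * L ≤ q (R c) * (x - c) := by
        calc q₁ * L ≤ q₁ * (x - c) := mul_le_mul_of_nonneg_left h2 hq₁0.le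
          _ ≤ q (R c) * (x - c) := mul_le_mul_of_nonneg_right hqc hxc0
      have h3' : R x - R c = R x - rmax := by rw [hc]
      linarith only [h, h', h3']
    have hrle : R x ≤ 7 * M + 2 * L := by
      have := hR.sub_le hMa hxc.le; rw [hc] at this; linarith only [this, h3, h7]
    have hqr : q₁ ≤ q (R x) := by
      have hle : rPlus M a + δ₁ ≤ R x := by linarith only [hδ₁d, hr₃, hgap, hd, hrgt]
      rw [hq₁']
      exact hq_mono _ _ hδ₁p hle
    have hr₃x : r₃ ≤ R x := by linarith only [hrgt, hgap, hd]
    -- `|V_r| ≥ b_VΛ(R x − r_max)/R x⁴ ≥ b_VΛ q₁ L/(7M + 2L)⁴`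
    obtain ⟨S, hS⟩ : ∃ S : ℝ, S = (7 * M + 2 * L) ^ 4 := ⟨_, rfl⟩
    have hS0 : 0 < S := by rw [hS]; positivity
    have hRS : R x ^ 4 ≤ S := by rw [hS]; exact pow_le_pow_left₀ hr0.le hrle 4
    have hΛC' : D / (L ^ 3 * I) ≤ q₁ ^ 2 * bV * L * Λ / (I * S) := by rw [hS]; exact hΛC
    have hVr_ge : bV * Λ * (q₁ * L) / S ≤ -Vr (R x) := by
      have h4 := hS4' (R x) hr₃x
      have hpos : 0 < R x - rmax := by linarith only [hrgt]
      have h5 : bV * Λ * (R x - rmax) / (R x) ^ 4 ≤ -Vr (R x) := by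
        have e : bV * Λ * (R x - rmax) ^ 2 / (R x) ^ 4 =
            (R x - rmax) * (bV * Λ * (R x - rmax) / (R x) ^ 4) := by ring
        have e2 : -((R x - rmax) * Vr (R x)) = (R x - rmax) * (-Vr (R x)) := by ring
        have h' : (R x - rmax) * (bV * Λ * (R x - rmax) / (R x) ^ 4) ≤
            (R x - rmax) * (-Vr (R x)) := by
          rw [← e, ← e2]; exact h4
        exact le_of_mul_le_mul_left h' hpos
      have h6 : bV * Λ * (q₁ * L) / S ≤ bV * Λ * (R x - rmax) / (R x) ^ 4 := by
        have hnum : bV * Λ * (q₁ * L) ≤ bV * Λ * (R x - rmax) :=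
          mul_le_mul_of_nonneg_left hgapL (by positivity)
        calc bV * Λ * (q₁ * L) / S ≤ bV * Λ * (q₁ * L) / (R x) ^ 4 :=
              div_le_div_of_nonneg_left (by positivity) (by positivity) hRS
          _ ≤ bV * Λ * (R x - rmax) / (R x) ^ 4 := div_le_div_of_nonneg_right hnum (by positivity)
      linarith only [h5, h6]
    have hmain : q₁ ^ 2 * bV * L * Λ / (I * S) ≤ fs x * (q (R x) * (-Vr (R x))) := by
      have h1' : 1 / I * (q₁ * (bV * Λ * (q₁ * L) / S)) ≤ fs x * (q (R x) * (-Vr (R x))) := by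
        apply mul_le_mul hfge _ (by positivity) ((div_pos one_pos hI0).le.trans hfge)
        exact mul_le_mul hqr hVr_ge (by positivity) hq0.le
      have e : 1 / I * (q₁ * (bV * Λ * (q₁ * L) / S)) = q₁ ^ 2 * bV * L * Λ / (I * S) := by ring
      linarith only [h1', e]
    have hf3 := hf'''_half x
    rewrite [hW, hYr, hY'r]
    have e : -(fs x * (Vr (R x) * q (R x))) = fs x * (q (R x) * (-Vr (R x))) := by ring
    have h7' : D / (2 * (L ^ 3 * I)) ≤ q₁ ^ 2 * bV * L * Λ / (I * S) / 2 := by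
      rw [hdiv2]; linarith only [hΛC']
    have hA0 : 0 ≤ q₁ ^ 2 * bV * L * Λ / (I * S) := by positivity
    linarith only [hmain, hf3, e, h7', le_abs_self (fs3 x), hA0]
  have hC3 : ∀ x, r₃ + θ < R x → 2 * L < x - c → 0 ≤ W x := by
    intro x h1 h2
    have hq0 := hqR_pos x
    have hYr : Y (R x) = 0 := hY_zero (R x) h1.le
    have hY'r : Y' (R x) = 0 := hY'_zero (R x) h1.le
    have hxc : c < x := by linarith only [h2, hL0]
    have hrgt : rmax < R x := by rw [← hc]; exact hR.strictMono hMa hxc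
    have hVneg : Vr (R x) < 0 := hS3b' (R x) hrgt
    have hx2 : c + 2 * L ≤ x := by linarith only [h2]
    have hf1 : fs x = 1 := hf_one x hx2
    have hxc' : 0 < x - c := by linarith only [h2, hL0]
    have habs : 2 * L < |x - c| := by rw [abs_of_pos hxc']; exact h2
    have hf3 : fs3 x = 0 := hf'''_gt x habs
    rewrite [hW, hYr, hY'r, hf1, hf3]
    have hprod : Vr (R x) * q (R x) ≤ 0 := mul_nonpos_of_nonpos_of_nonneg hVneg.le hq0.le
    linarith only [hprod]
  /- ─────────────── (i): non-negativity everywhere ─────────────── -/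
  have hWnonneg : ∀ x, 0 ≤ W x := by
    intro x
    rcases le_or_gt (R x) r₃ with h | h
    · exact le_trans (by have := hqR_pos x; positivity) (hA x h)
    rcases le_or_gt (R x) (r₃ + θ) with h' | h'
    · obtain ⟨hWB, hxc, hVpos, -⟩ := hB x h h'
      refine le_trans ?_ hWB
      have := hqR_pos x
      have hcx : 0 ≤ c - x := by linarith only [hxc]
      exact mul_nonneg (div_nonneg (mul_nonneg this.le hcx) (by positivity)) hVpos.le
    -- region C: `x > c − L`
    have hxcL : c - L < x := by
      by_contra hh; push Not at hh
      have hxc : x ≤ c := by linarith only [hh, hL0]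
      have hRx : R x ≤ Rb := by
        have := hRmono hxc; rw [hc] at this
        linarith only [this, h7, hRb]
      have hr₃x : r₃ ≤ R x := by linarith only [h', hθ]
      have := hzone₃ x hr₃x hRx
      rw [abs_lt] at this; linarith only [this.1, hh, hL0]
    rcases lt_or_ge (x - c) L with h1 | h1
    · have hlin : |x - c| < L := by
        rw [abs_lt]; constructor <;> linarith only [hxcL, h1]
      exact le_trans (by have := hqR_pos x; positivity) (hC1 x h' hlin)
    rcases le_or_gt (x - c) (2 * L) with h2 | h2
    · exact hC2 x h' h1 h2
    · exact hC3 x h' h2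
  refine ⟨fun x ↦ ?_, fun x hx ↦ ?_⟩
  · rw [hbulk]
    exact add_nonneg (mul_nonneg (hP_nonneg x) (sq_nonneg _))
      (mul_nonneg (hWnonneg x) (sq_nonneg _))
  /- ─────────────── (ii): coercivity on `[X₁, X₂]` ─────────────── -/
  · obtain ⟨β, hβ⟩ : ∃ β : ℝ, β = min (2 / (L * I)) (q₁ ^ 3 * bV / (L * I * Rb ^ 4)) := ⟨_, rfl⟩
    rw [← hβ]
    have hlin : |x - c| < L := hzoneX x hx
    have hq0 := hqR_pos x
    have hRX₁ : rPlus M a + δ₁ ≤ R x := by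
      have := hRmono hx.1; linarith only [this, hX₁, hδ₁δ₀]
    have hδ₁p : rPlus M a ≤ rPlus M a + δ₁ := by linarith only [hδ₁0]
    have hqr : q₁ ≤ q (R x) := by
      rw [hq₁']; exact hq_mono _ _ hδ₁p hRX₁
    have hrRb : R x ≤ Rb := (hRmono hx.2).trans hX₂
    have hr0 : 0 < R x := hrp0.trans (hRgt x)
    -- `(R x − r_max)² ≥ q₁²(x − c)²`
    have hsq : q₁ ^ 2 * (x - c) ^ 2 ≤ (R x - rmax) ^ 2 := by
      have h := hdist x hRX₁
      have h0 : 0 ≤ q₁ * |x - c| := by positivity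
      calc q₁ ^ 2 * (x - c) ^ 2 = (q₁ * |x - c|) ^ 2 := by rw [mul_pow, sq_abs]
        _ ≤ |R x - rmax| ^ 2 := pow_le_pow_left₀ h0 h _
        _ = (R x - rmax) ^ 2 := sq_abs _
    -- `|u₁|²`
    have hP2 : β ≤ P x := by rw [hβ]; exact (min_le_left _ _).trans (hP_lin x hlin.le)
    -- `|u|²`: `W ≥ (q₁ b_V/(L I R_b⁴)) Λ (R x − r_max)²`
    have hκ : q₁ * bV / (L * I * Rb ^ 4) * Λ * (R x - rmax) ^ 2 ≤ W x := by
      rcases le_or_gt (R x) r₃ with h | h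
      · -- region A
        have hWA := hA x h
        have hdr : (R x - rmax) ^ 2 ≤ Rb ^ 2 := by
          have : |R x - rmax| ≤ Rb := by
            rw [abs_le]
            constructor <;> linarith only [hRgt x, hrmaxp, hrp0, h7, hRb, h, hr₃, hd, hgap]
          calc (R x - rmax) ^ 2 = |R x - rmax| ^ 2 := (sq_abs _).symm
            _ ≤ Rb ^ 2 := pow_le_pow_left₀ (abs_nonneg _) this 2
        have h1 : q₁ * bV / (L * I * Rb ^ 4) * Λ * (R x - rmax) ^ 2 ≤
            q₁ * bV / (L * I * Rb ^ 4) * Λ * Rb ^ 2 :=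
          mul_le_mul_of_nonneg_left hdr (by positivity)
        have h2 : q₁ * bV / (L * I * Rb ^ 4) * Λ * Rb ^ 2 ≤ C * bV / 4 * q₁ * Λ := by
          rw [div_mul_eq_mul_div, div_mul_eq_mul_div, div_le_iff₀ (by positivity)]
          have hz : 0 ≤ bV * q₁ * Λ * Rb ^ 2 / 4 := by positivity
          have := mul_le_mul_of_nonneg_right hC'' hz
          linarith only [this]
        have h4 : C * bV / 4 * q₁ * Λ ≤ C * bV / 4 * q (R x) * Λ := by
          apply mul_le_mul_of_nonneg_right _ hΛ0.le
          exact mul_le_mul_of_nonneg_left hqr (by positivity)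
        linarith only [hWA, h1, h2, h4]
      rcases le_or_gt (R x) (r₃ + θ) with h' | h'
      · -- region B
        obtain ⟨hWB, hxc, hVpos, hS4r⟩ := hB x h h'
        have hcx : rmax - R x ≤ c - x := by
          have := hR.sub_le hMa hxc.le; rw [hc] at this; linarith only [this]
        have hpos : 0 ≤ rmax - R x := by linarith only [h', hθd, hgap, hd]
        calc q₁ * bV / (L * I * Rb ^ 4) * Λ * (R x - rmax) ^ 2
            = q₁ * (rmax - R x) / (L * I) * (bV * Λ * (rmax - R x) / Rb ^ 4) := by ring
          _ ≤ q (R x) * (c - x) / (L * I) * (bV * Λ * (rmax - R x) / (R x) ^ 4) := by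
              apply mul_le_mul _ _ (by positivity) (by positivity)
              · apply div_le_div_of_nonneg_right _ (by positivity)
                exact mul_le_mul hqr hcx hpos hq0.le
              · apply div_le_div_of_nonneg_left (by positivity) (by positivity)
                exact pow_le_pow_left₀ hr0.le hrRb 4
          _ ≤ q (R x) * (c - x) / (L * I) * Vr (R x) := by
              have hcx0 : 0 ≤ c - x := by linarith only [hxc]
              exact mul_le_mul_of_nonneg_left hS4r (by positivity)
          _ ≤ W x := hWB
      · -- region C1
        have hWC := hC1 x h' hlin
        calc q₁ * bV / (L * I * Rb ^ 4) * Λ * (R x - rmax) ^ 2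
            = q₁ / (L * I) * (bV * Λ * (R x - rmax) ^ 2 / Rb ^ 4) := by ring
          _ ≤ q (R x) / (L * I) * (bV * Λ * (R x - rmax) ^ 2 / (R x) ^ 4) := by
              apply mul_le_mul _ _ (by positivity) (by positivity)
              · exact div_le_div_of_nonneg_right hqr (by positivity)
              · apply div_le_div_of_nonneg_left (by positivity) (by positivity)
                exact pow_le_pow_left₀ hr0.le hrRb 4
          _ ≤ W x := hWC
    have hWβ : β * (Λ * (x - c) ^ 2) ≤ W x := by
      have h1 : β ≤ q₁ ^ 3 * bV / (L * I * Rb ^ 4) := by rw [hβ]; exact min_le_right _ _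
      calc β * (Λ * (x - c) ^ 2) ≤ q₁ ^ 3 * bV / (L * I * Rb ^ 4) * (Λ * (x - c) ^ 2) :=
            mul_le_mul_of_nonneg_right h1 (by positivity)
        _ = q₁ * bV / (L * I * Rb ^ 4) * Λ * (q₁ ^ 2 * (x - c) ^ 2) := by ring
        _ ≤ q₁ * bV / (L * I * Rb ^ 4) * Λ * (R x - rmax) ^ 2 :=
            mul_le_mul_of_nonneg_left hsq (by positivity)
        _ ≤ W x := hκ
    rw [hbulk]
    have e : β * (‖u₁ x‖ ^ 2 + Λ * (x - c) ^ 2 * ‖u x‖ ^ 2) =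
        β * ‖u₁ x‖ ^ 2 + β * (Λ * (x - c) ^ 2) * ‖u x‖ ^ 2 := by ring
    rw [e]
    exact add_le_add (mul_le_mul_of_nonneg_right hP2 (sq_nonneg _))
      (mul_le_mul_of_nonneg_right hWβ (sq_nonneg _))

end FinBulk

/-! ### The trapping estimate in the case `r₃ < ∞` -/

section FinEstimate

variable {M a ω Λ E r₃ rmax bV d δ₀ Rb c L C θ D q₁ qlow Kω x₁ x₂ Atop Abot : ℝ} {m : ℤ}
  {R : ℝ → ℝ} {u u₁ u₂ H : ℝ → ℂ}

set_option maxHeartbeats 1600000 in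
/-- **The trapping estimate (thisisspartaEst) in the case `r₃ < ∞` (`r_trap = r_max`), explicit
multipliers.** In the situation of `trapBulk_fin_bounds` (structure of `V`, parameters `L, C, θ`,
`Λ` large) on the enlarged region `[x₁ − 1, x₂ + 1]`, let moreover `ω² ≤ K_ωΛ` (`K_ω = ε⁻¹_width` in
`𝓖_♮`), `E ≥ 2` and `2(1 − Y(r₊))(ω − ω₊m)² ≤ Eω(ω − ω₊m)` (the horizon boundary term: "for all `E`
such that `C ≪ E`, the non-superradiant condition … ensure[s] that both boundary terms … are
positive"), and let `u` be a `C²` solution of `u'' + (ω² − V(R))u = H` on `ℝ ∋ x = r*` with the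
boundary behaviour (eq:b±). Then
`b ∫_{x₁}^{x₂} (|u'|² + ((ω² + Λ)(1 − r_max/R)² + 1)|u|²) dr*`
`  ≤ ∫ (−2f Re(u'H̄) − f' Re(uH̄) − 2ŷ Re(u'H̄) + Eω Im(Hū)) dr*`
with `b = β/(69 + (K_ω + 1)/M²)`, `β = min(2/(LI), q₁³b_V/(LIR_b⁴))` — DRSR arXiv:1402.7034,
Prop. 8.6.1 with `r_trap = r_max`: the bulk identity
(`KerrCombinedCurrent.combined_estimate_of_boundary_sign`) gives `β∫_{x₁−1}^{x₂+1}(|u'|² + Λ(x − c)²|u|²)`, and the concentration inequality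
(`KerrTrappingMultipliers.integral_norm_sq_le_of_concentration`) together with
`(ω² + Λ)(1 − r_max/R)² ≤ (K_ω + 1)Λ(x − c)²/M²` converts the weight.
[cite: DafermosRodnianskiShlapentokhrothman2014, Prop. 8.6.1] -/
theorem trapping_estimate_fin (hMa : IsSubextremal M a) (hR : IsTortoiseRadius M a R)
    (hadm : IsAdmissibleTriple a ω m Λ) (hΛ1 : 1 ≤ Λ) (hbV : 0 < bV) (hd : 0 < d) (hδ₀ : 0 < δ₀)
    (hr₃ : rPlus M a + d ≤ r₃) (hgap : r₃ + d ≤ rmax) (h7 : rmax < 7 * M)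
    (hS2 : ∀ r ∈ Icc (rPlus M a) r₃, sepPotential M a ω m Λ r ≤ ω ^ 2 - bV * Λ)
    (hS3a : ∀ r ∈ Ico r₃ rmax, 0 < deriv (sepPotential M a ω m Λ) r)
    (hS3b : ∀ r ∈ Ioi rmax, deriv (sepPotential M a ω m Λ) r < 0)
    (hS4 : ∀ r ∈ Ici r₃, bV * Λ * (r - rmax) ^ 2 / r ^ 4 ≤
      -((r - rmax) * deriv (sepPotential M a ω m Λ) r))
    (hc : R c = rmax) (hRb : 7 * M ≤ Rb) (hx : x₁ ≤ x₂) (hX₁ : rPlus M a + δ₀ ≤ R (x₁ - 1))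
    (hX₂ : R (x₂ + 1) ≤ Rb)
    (hq₁ : q₁ = delta M a (rPlus M a + min δ₀ d) / ((rPlus M a + min δ₀ d) ^ 2 + a ^ 2))
    (hqlow : qlow = delta M a (rPlus M a + 2 * d * Real.exp (-(2 * L) / M)) /
      ((rPlus M a + 2 * d * Real.exp (-(2 * L) / M)) ^ 2 + a ^ 2))
    (hD : ∀ t, |sharpBump₂ t| ≤ D) (hL : Rb / q₁ + 1 ≤ L)
    (hC : 4 * (208 / M ^ 3) / bV ≤ C) (hC' : 4 / (L * sharpBumpMass * Rb ^ 2) ≤ C)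
    (hθ : 0 < θ) (hθd : θ ≤ d / 2) (hθB : θ * (208 / M ^ 3) ≤ bV / 2)
    (hΛA : D / (L ^ 3 * sharpBumpMass) ≤ C * bV / 4 * qlow * Λ)
    (hΛC : D / (L ^ 3 * sharpBumpMass) ≤
      q₁ ^ 2 * bV * L * Λ / (sharpBumpMass * (7 * M + 2 * L) ^ 4))
    (hKω : ω ^ 2 ≤ Kω * Λ) (hKω0 : 0 ≤ Kω) (hE : 2 ≤ E)
    (hEbd : 2 * (1 - trapWeight C r₃ θ (rPlus M a)) * (ω - horizonAngularVelocity M a * m) ^ 2 ≤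
      E * (ω * (ω - horizonAngularVelocity M a * m)))
    (hu : ∀ x, HasDerivAt u (u₁ x) x) (hu₁ : ∀ x, HasDerivAt u₁ (u₂ x) x)
    (hode : ∀ x, u₂ x + ((ω ^ 2 - sepPotential M a ω m Λ (R x) : ℝ) : ℂ) * u x = H x)
    (hH : Continuous H) (hS₁ : Integrable fun x ↦ ⟪H x, u₁ x⟫_ℝ)
    (hS₂ : Integrable fun x ↦ (H x * conj (u x)).im)
    (hb_top : Tendsto (fun x ↦ u₁ x - Complex.I * ω * u x) atTop (𝓝 0))
    (hb_bot : Tendsto (fun x ↦ u₁ x +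
      Complex.I * ((ω - horizonAngularVelocity M a * m : ℝ) : ℂ) * u x) atBot (𝓝 0))
    (hA_top : Tendsto (fun x ↦ ‖u x‖ ^ 2) atTop (𝓝 Atop))
    (hA_bot : Tendsto (fun x ↦ ‖u x‖ ^ 2) atBot (𝓝 Abot)) :
    min (2 / (L * sharpBumpMass)) (q₁ ^ 3 * bV / (L * sharpBumpMass * Rb ^ 4)) /
          (69 + (Kω + 1) / M ^ 2) *
        ∫ x in x₁..x₂, (‖u₁ x‖ ^ 2 + ((ω ^ 2 + Λ) * (1 - rmax / R x) ^ 2 + 1) * ‖u x‖ ^ 2) ≤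
      ∫ x, combinedSource ω (ω - horizonAngularVelocity M a * m) E
        (trapMultipliers M a c L 0 1 C r₃ θ R) u u₁ H x := by
  have hM := hMa.pos
  have haM : |a| ≤ M := le_of_lt hMa
  have hΛ0 : 0 < Λ := one_pos.trans_le hΛ1
  have hq₁0 : 0 < q₁ := by
    have hmin : 0 < min δ₀ d := lt_min hδ₀ hd
    have hpos : 0 < rPlus M a + min δ₀ d := by
      have := M_le_rPlus M a; linarith
    rw [hq₁]
    exact div_pos (Kerr.delta_pos haM (by linarith)) (by positivity)
  have hRb0 : 0 < Rb := by linarith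
  have hL0 : 0 < L := by
    have : 0 ≤ Rb / q₁ := div_nonneg hRb0.le hq₁0.le
    linarith
  have hC0 : 0 < C := lt_of_lt_of_le (by positivity) hC
  -- the pointwise bounds on `[x₁ − 1, x₂ + 1]`
  obtain ⟨hP0, hcoer⟩ := trapBulk_fin_bounds (E := E) (u := u) (u₁ := u₁) hMa hR hadm hΛ1 hbV hd
    hδ₀ hr₃ hgap h7 hS2 hS3a hS3b hS4 hc hRb hX₁ hX₂ hq₁ hqlow hD hL hC hC' hθ hθd hθB hΛA hΛC
  obtain ⟨β, hβ⟩ : ∃ β : ℝ,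
      β = min (2 / (L * sharpBumpMass)) (q₁ ^ 3 * bV / (L * sharpBumpMass * Rb ^ 4)) := ⟨_, rfl⟩
  rw [← hβ] at hcoer ⊢
  have hβ0 : 0 < β := by
    rw [hβ]; have := sharpBumpMass_pos
    exact lt_min (by positivity) (by positivity)
  -- the data of the abstract estimate
  set ϖ : ℝ := ω - horizonAngularVelocity M a * m with hϖ
  set μ := trapMultipliers M a c L 0 1 C r₃ θ R with hμ
  set V : ℝ → ℝ := fun x ↦ sepPotential M a ω m Λ (R x) with hVdef
  set V' : ℝ → ℝ := fun x ↦ deriv (sepPotential M a ω m Λ) (R x) *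
    (delta M a (R x) / (R x ^ 2 + a ^ 2)) with hV'def
  have hV : ∀ x, HasDerivAt V (V' x) x := fun x ↦ hasDerivAt_sepPotential_comp hR hMa x
  have hμd : μ.HasDerivs := hasDerivs_trapMultipliers hR c L 0 1 C r₃ θ
  have hbdry : OutgoingBoundary ω ϖ V u u₁ Atop Abot :=
    { sub_top := hb_top
      add_bot := hb_bot
      normSq_top := hA_top
      normSq_bot := hA_bot
      potential_top := tendsto_sepPotential_comp_atTop hR hMa hadm
      potential_bot := tendsto_sepPotential_comp_atBot hR hMa }
  have htop : μ.EndLimits atTop (0 + 1) 0 0 1 :=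
    endLimits_trapMultipliers_atTop hR hL0 hθ.le c 0 1 C r₃
  have hbot : μ.EndLimits atBot (0 - 1) (trapWeight C r₃ θ (rPlus M a)) 0 1 :=
    endLimits_trapMultipliers_atBot hR hL0 c 0 1 C r₃ θ
  -- integrability of the source term
  have huc : Continuous u := continuous_iff_continuousAt.2 fun x ↦ (hu x).continuousAt
  have hu₁c : Continuous u₁ := continuous_iff_continuousAt.2 fun x ↦ (hu₁ x).continuousAt
  have hfc : Continuous μ.f := continuous_iff_continuousAt.2 fun x ↦ (hμd.df x).continuousAt
  have hf'c : Continuous μ.f' := continuous_iff_continuousAt.2 fun x ↦ (hμd.df' x).continuousAt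
  have hyc : Continuous fun x ↦ trapWeight C r₃ θ (R x) :=
    (continuous_trapWeight C r₃ θ).comp hR.continuous
  have hSrc : Integrable (combinedSource ω ϖ E μ u u₁ H) := by
    have heq : combinedSource ω ϖ E μ u u₁ H = fun x ↦
        (-2 * μ.f x) * ⟪H x, u₁ x⟫_ℝ + -(μ.f' x * ⟪H x, u x⟫_ℝ) +
          (-2 * trapWeight C r₃ θ (R x)) * ⟪H x, u₁ x⟫_ℝ + E * (ω * (H x * conj (u x)).im) := by
      funext x
      rw [hμ, combinedSource_trapMultipliers]
      ring
    rw [heq]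
    refine ((Integrable.add ?_ ?_).add ?_).add ?_
    · refine hS₁.bdd_mul (c := 2) (by fun_prop) (Eventually.of_forall fun x ↦ ?_)
      have h := sharpMultipliers_abs_f_le_one c L 1 0 x
      have e : μ.f x = (sharpMultipliers c L 1 0).f x := by
        rw [hμ, (trapMultipliers_f M a c L 0 1 C r₃ θ R x).1]; ring
      rw [Real.norm_eq_abs, abs_mul, e]
      have : |(-2 : ℝ)| = 2 := by norm_num
      rw [this]
      nlinarith [abs_nonneg ((sharpMultipliers c L 1 0).f x)]
    · refine (Continuous.integrable_of_hasCompactSupport (hf'c.mul (hH.inner huc)) ?_).neg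
      refine HasCompactSupport.intro (isCompact_Icc (a := c - 2 * L) (b := c + 2 * L))
        fun x hx ↦ ?_
      have habs : 2 * L ≤ |x - c| := by
        rcases lt_or_ge x (c - 2 * L) with h | h
        · rw [abs_of_neg (by linarith)]; linarith
        · have : c + 2 * L < x := by
            by_contra h'; push Not at h'; exact hx ⟨h, h'⟩
          rw [abs_of_pos (by linarith)]; linarith
      have e : μ.f' x = (sharpMultipliers c L 1 0).f' x := by
        rw [hμ, (trapMultipliers_f M a c L 0 1 C r₃ θ R x).2.1]; ring
      change μ.f' x * ⟪H x, u x⟫_ℝ = 0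
      rw [e, sharpMultipliers_f'_eq_zero (d := 1) (A := 0) hL0 habs, zero_mul]
    · obtain ⟨Γ, hΓ⟩ : ∃ Γ : ℝ, Γ = Real.exp (C * (r₃ + θ / 2 - rPlus M a)) := ⟨_, rfl⟩
      refine hS₁.bdd_mul (c := 2 * Γ) (continuous_const.mul hyc).aestronglyMeasurable
        (Eventually.of_forall fun x ↦ ?_)
      have hr₃p : rPlus M a ≤ r₃ := by linarith
      have h := one_sub_trapWeight_mem_Icc (C := C) (θ := θ) (r := R x) hC0.le hθ hr₃p
        (hR.rPlus_lt x).le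
      have hY0 := trapWeight_nonpos hC0.le hθ r₃ (R x)
      have h1 : |(-2 : ℝ)| = 2 := by norm_num
      have h2 : 1 - trapWeight C r₃ θ (R x) ≤ Γ := by rw [hΓ]; exact h.2
      rw [Real.norm_eq_abs, abs_mul, h1, abs_of_nonpos hY0]
      linarith
    · exact (hS₂.const_mul ω).const_mul E
  -- the abstract estimate on `[x₁ − 1, x₂ + 1]`
  have hw : Continuous fun x : ℝ ↦ Λ * (x - c) ^ 2 := by fun_prop
  have hX : x₁ - 1 ≤ x₂ + 1 := by linarith
  have hsign_top : 2 * ((0 + 1) + 0) * ω ^ 2 ≤ E * (1 * ω ^ 2 + 0 * ϖ * ω) := by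
    have := mul_le_mul_of_nonneg_right hE (sq_nonneg ω)
    linarith
  have hsign_bot : 0 ≤ 2 * ((0 - 1) + trapWeight C r₃ θ (rPlus M a)) * ϖ ^ 2 +
      E * (1 * ω * ϖ + 0 * ϖ ^ 2) := by
    linarith [hEbd]
  have hest := combined_estimate_of_boundary_sign hV hμd hu hu₁ hode hH hSrc hbdry htop hbot hP0 hw
    hX hcoer hsign_top hsign_bot
  -- integral bookkeeping
  have huc2 : Continuous fun x ↦ ‖u x‖ ^ 2 := by fun_prop
  have hi1 : IntervalIntegrable (fun x ↦ ‖u₁ x‖ ^ 2) volume (x₁ - 1) (x₂ + 1) := by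
    apply Continuous.intervalIntegrable; fun_prop
  have hi2 : IntervalIntegrable (fun x ↦ Λ * (x - c) ^ 2 * ‖u x‖ ^ 2) volume (x₁ - 1) (x₂ + 1) := by
    apply Continuous.intervalIntegrable; fun_prop
  rw [intervalIntegral.integral_add hi1 hi2] at hest
  have hA0 : 0 ≤ ∫ x in (x₁ - 1)..(x₂ + 1), ‖u₁ x‖ ^ 2 :=
    intervalIntegral.integral_nonneg hX fun x _ ↦ by positivity
  have hBq0 : 0 ≤ ∫ x in (x₁ - 1)..(x₂ + 1), Λ * (x - c) ^ 2 * ‖u x‖ ^ 2 :=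
    intervalIntegral.integral_nonneg hX fun x _ ↦ by positivity
  -- concentration
  have hconc := integral_norm_sq_le_of_concentration (c := c) hx hΛ1 hu hu₁c
  -- monotone enlargement of the interval
  have hmono1 : ∫ x in x₁..x₂, ‖u₁ x‖ ^ 2 ≤ ∫ x in (x₁ - 1)..(x₂ + 1), ‖u₁ x‖ ^ 2 :=
    intervalIntegral.integral_mono_interval (by linarith) hx (by linarith)
      (Eventually.of_forall fun x ↦ by positivity) hi1
  have hmono2 : ∫ x in x₁..x₂, Λ * (x - c) ^ 2 * ‖u x‖ ^ 2 ≤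
      ∫ x in (x₁ - 1)..(x₂ + 1), Λ * (x - c) ^ 2 * ‖u x‖ ^ 2 :=
    intervalIntegral.integral_mono_interval (by linarith) hx (by linarith)
      (Eventually.of_forall fun x ↦ by positivity) hi2
  -- the weight on `[x₁, x₂]`
  obtain ⟨k, hk⟩ : ∃ k : ℝ, k = (Kω + 1) / M ^ 2 := ⟨_, rfl⟩
  have hk0 : 0 ≤ k := by rw [hk]; positivity
  have hpt : ∀ x ∈ Icc x₁ x₂,
      ‖u₁ x‖ ^ 2 + ((ω ^ 2 + Λ) * (1 - rmax / R x) ^ 2 + 1) * ‖u x‖ ^ 2 ≤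
        ‖u₁ x‖ ^ 2 + k * (Λ * (x - c) ^ 2 * ‖u x‖ ^ 2) + ‖u x‖ ^ 2 := by
    intro x _
    have hRx : M < R x := lt_of_le_of_lt (M_le_rPlus M a) (hR.rPlus_lt x)
    have hR0 : 0 < R x := hM.trans hRx
    have h1 : (1 - rmax / R x) ^ 2 = (R x - rmax) ^ 2 / R x ^ 2 := by
      field_simp
    have h2 : (R x - rmax) ^ 2 ≤ (x - c) ^ 2 := by
      have h := hR.abs_sub_le hMa c x
      rw [hc] at h
      calc (R x - rmax) ^ 2 = |R x - rmax| ^ 2 := (sq_abs _).symm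
        _ ≤ |x - c| ^ 2 := pow_le_pow_left₀ (abs_nonneg _) h 2
        _ = (x - c) ^ 2 := sq_abs _
    have h3 : (R x - rmax) ^ 2 / R x ^ 2 ≤ (x - c) ^ 2 / M ^ 2 := by
      calc (R x - rmax) ^ 2 / R x ^ 2 ≤ (x - c) ^ 2 / R x ^ 2 :=
            div_le_div_of_nonneg_right h2 (by positivity)
        _ ≤ (x - c) ^ 2 / M ^ 2 := by
            apply div_le_div_of_nonneg_left (by positivity) (by positivity)
            exact pow_le_pow_left₀ hM.le hRx.le 2
    have h4 : ω ^ 2 + Λ ≤ (Kω + 1) * Λ := by linarith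
    have h5 : (ω ^ 2 + Λ) * (1 - rmax / R x) ^ 2 ≤ k * (Λ * (x - c) ^ 2) := by
      rw [h1]
      calc (ω ^ 2 + Λ) * ((R x - rmax) ^ 2 / R x ^ 2) ≤ ((Kω + 1) * Λ) * ((x - c) ^ 2 / M ^ 2) :=
            mul_le_mul h4 h3 (by positivity) (by positivity)
        _ = k * (Λ * (x - c) ^ 2) := by rw [hk]; ring
    have h6 := mul_le_mul_of_nonneg_right h5 (sq_nonneg ‖u x‖)
    nlinarith [h6]
  have hlhs_i : IntervalIntegrable
      (fun x ↦ ‖u₁ x‖ ^ 2 + ((ω ^ 2 + Λ) * (1 - rmax / R x) ^ 2 + 1) * ‖u x‖ ^ 2) volume x₁ x₂ := by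
    apply Continuous.intervalIntegrable
    have hRc := hR.continuous
    have hRne : ∀ x, R x ≠ 0 := fun x ↦ (hR.pos hMa x).ne'
    fun_prop (disch := exact hRne _)
  have hrhs_i : IntervalIntegrable
      (fun x ↦ ‖u₁ x‖ ^ 2 + k * (Λ * (x - c) ^ 2 * ‖u x‖ ^ 2) + ‖u x‖ ^ 2) volume x₁ x₂ := by
    apply Continuous.intervalIntegrable; fun_prop
  have hint := intervalIntegral.integral_mono_on hx hlhs_i hrhs_i hpt
  have hi1' : IntervalIntegrable (fun x ↦ ‖u₁ x‖ ^ 2) volume x₁ x₂ := by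
    apply Continuous.intervalIntegrable; fun_prop
  have hi2' : IntervalIntegrable (fun x ↦ k * (Λ * (x - c) ^ 2 * ‖u x‖ ^ 2)) volume x₁ x₂ := by
    apply Continuous.intervalIntegrable; fun_prop
  have hi3' : IntervalIntegrable (fun x ↦ ‖u x‖ ^ 2) volume x₁ x₂ := by
    apply Continuous.intervalIntegrable; fun_prop
  rw [intervalIntegral.integral_add (hi1'.add hi2') hi3', intervalIntegral.integral_add hi1' hi2',
    intervalIntegral.integral_const_mul] at hint
  -- combine
  set A := ∫ x in (x₁ - 1)..(x₂ + 1), ‖u₁ x‖ ^ 2 with hA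
  set Bq := ∫ x in (x₁ - 1)..(x₂ + 1), Λ * (x - c) ^ 2 * ‖u x‖ ^ 2 with hBq
  set Ixx := ∫ x in x₁..x₂, (‖u₁ x‖ ^ 2 + ((ω ^ 2 + Λ) * (1 - rmax / R x) ^ 2 + 1) * ‖u x‖ ^ 2)
    with hIxx
  set Ssrc := ∫ x, combinedSource ω ϖ E μ u u₁ H x with hSsrc
  have hkI := mul_le_mul_of_nonneg_left hmono2 hk0
  have hkA := mul_nonneg hk0 hA0
  have hIxx_le : Ixx ≤ (69 + k) * (A + Bq) := by
    linarith only [hint, hmono1, hkI, hconc, hA0, hBq0, hkA]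
  have hpos : 0 < 69 + k := by linarith only [hk0]
  rw [← hk, div_mul_eq_mul_div, div_le_iff₀ hpos]
  have h1 := mul_le_mul_of_nonneg_left hIxx_le hβ0.le
  have h2 := mul_le_mul_of_nonneg_left hest hpos.le
  linarith only [h1, h2]

end FinEstimate


/-! ### The case `r₃ = ∞`: auxiliary inequalities -/

section InfAux

variable {C ρ θ r : ℝ}

/-- On `[ρ, ρ + θ]`: `ψ = (ρ + θ − r)²/(2θ)`. [folklore] -/
theorem trapRamp_of_mem (h1 : ρ ≤ r) (h2 : r ≤ ρ + θ) :
    trapRamp ρ θ r = (ρ + θ - r) ^ 2 / (2 * θ) := by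
  unfold trapRamp
  rw [max_eq_right (by linarith : ρ - r ≤ 0), max_eq_left (by linarith : 0 ≤ ρ + θ - r)]
  ring

/-- On `[ρ, ρ + θ]`: `ψ' = −(ρ + θ − r)/θ`. [folklore] -/
theorem trapRampDeriv_of_mem (h1 : ρ ≤ r) (h2 : r ≤ ρ + θ) :
    trapRampDeriv ρ θ r = -((ρ + θ - r) / θ) := by
  unfold trapRampDeriv
  rw [max_eq_right (by linarith : ρ - r ≤ 0), max_eq_left (by linarith : 0 ≤ ρ + θ - r), sub_zero]

/-- **`|Y| ≤ ((ρ + θ − r)/2)·dY/dr` on `[ρ, ρ + θ]`** (`C ≥ 0`, `θ > 0`): with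
`ψ = (ρ + θ − r)²/(2θ)`, `|Y| = e^{Cψ} − 1 ≤ Cψe^{Cψ}` and `dY/dr = C((ρ + θ − r)/θ)e^{Cψ}`. This is what makes the `C¹`
continuation of the horizon weight harmless: on `[ρ, ρ + θ]` the term `−ŷV'` is dominated by
`ŷ'(ω² − V)` as soon as `θ|V'| ≤ 2(ω² − V)`. [folklore] -/
theorem abs_trapWeight_le_mul_deriv (hC : 0 ≤ C) (hθ : 0 < θ) (h1 : ρ ≤ r) (h2 : r ≤ ρ + θ) :
    |trapWeight C ρ θ r| ≤ (ρ + θ - r) / 2 * trapWeightDeriv C ρ θ r := by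
  have hψ := trapRamp_of_mem (θ := θ) h1 h2
  have hψ' := trapRampDeriv_of_mem (θ := θ) h1 h2
  have hY0 := trapWeight_nonpos hC hθ ρ r
  rw [abs_of_nonpos hY0]
  unfold trapWeight trapWeightDeriv
  rw [hψ', hψ]
  set t := C * ((ρ + θ - r) ^ 2 / (2 * θ)) with ht
  -- `eᵗ − 1 ≤ t eᵗ` (from `1 − t ≤ e^{−t}`; also `AreaLaw.exp_sub_one_le_mul_exp` in the QFT corner
  -- of the library, not imported here)
  have h : Real.exp t - 1 ≤ t * Real.exp t := by
    have h1 : 1 - t ≤ Real.exp (-t) := Real.one_sub_le_exp_neg t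
    have h2 : 0 < Real.exp t := Real.exp_pos t
    have h3 : Real.exp t * (1 - t) ≤ Real.exp t * Real.exp (-t) :=
      mul_le_mul_of_nonneg_left h1 h2.le
    rw [← Real.exp_add, add_neg_cancel, Real.exp_zero] at h3
    nlinarith
  have e : (ρ + θ - r) / 2 * -(C * -((ρ + θ - r) / θ) * Real.exp t) = t * Real.exp t := by
    rw [ht]; ring
  rw [e]
  linarith

/-- **`q(r) = Δ/(r² + a²) ≥ 7/10` for `r ≥ 7M`** (`|a| < M`):
`q(7M) = (35M² + a²)/(49M² + a²) ≥ 7/10` and `q` is non-decreasing. [folklore] -/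
theorem seven_tenths_le_delta_div {M a r : ℝ} (hMa : IsSubextremal M a) (hr : 7 * M ≤ r) :
    7 / 10 ≤ delta M a r / (r ^ 2 + a ^ 2) := by
  have hM := hMa.pos
  have haM : |a| ≤ M := le_of_lt hMa
  have ha2 : a ^ 2 ≤ M ^ 2 := by nlinarith [sq_abs a, abs_nonneg a]
  have h7 : 7 / 10 ≤ delta M a (7 * M) / ((7 * M) ^ 2 + a ^ 2) := by
    rw [le_div_iff₀ (by positivity)]
    unfold delta
    nlinarith
  refine h7.trans (delta_div_mono hM.le (by positivity) ?_ hr)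
  calc |a| ≤ M := haM
    _ ≤ 7 * M := by linarith

end InfAux

/-! ### The trapping estimate in the case `r₃ = ∞` (`r_trap = 0`) -/

section InfEstimate

variable {M a ω Λ E bV δ₀ Rb xb ρ C θ D Kω x₁ x₂ Atop Abot : ℝ} {m : ℤ} {R : ℝ → ℝ}
  {u u₁ u₂ H : ℝ → ℂ}

set_option maxHeartbeats 1600000 in
/-- **The estimate (thisisspartaEst) in the case `r₃ = ∞` (`V ≤ ω² − b_VΛ` on the whole of
`[r₊, ∞)`, `r_trap = 0`), explicit multipliers.** Current `Q = Q^f + ϟ^ŷ − EQ^T` with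
`f = ½ + ½Φ(x − c)/I` a step from `0` (`x ≤ c − 2`) to `1` (`x ≥ c + 2`) placed beyond the region,
`c = x_b + 2` where `R(x_b) = R_b ≥ 7M` (so `f ≠ 0` only where `dV/dr < 0`), and the horizon weight
`ŷ = Y ∘ R`, `Y = trapWeight C ρ θ` with `ρ ≥ R(x_b + 5)` (so the transition of `f` lies inside the
region where `dY/dr = C(1 − Y)`), `C ≥ 2B₁/b_V`, `θB₁ ≤ 2b_V` (the `C¹` tail of `Y`,
`abs_trapWeight_le_mul_deriv`), `Λ` large (`D/I ≤ (7/10)Cb_VΛ`, absorbing `½|f'''| ≤ D/(4I)`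
where `q ≥ 7/10`); boundary terms as in the finite case. For a region `[x₁, x₂]` with
`R(x₁) ≥ r₊ + δ₀`, `R(x₂) ≤ R_b` and `ω² ≤ K_ωΛ`:
`b ∫_{x₁}^{x₂} (|u'|² + (ω² + Λ + 1)|u|²) dr* ≤ ∫ source`, `b = Cq_δ min(1, b_V/(4(K_ω + 2)))`,
`q_δ = q(r₊ + δ₀)`. This is the second construction in the proof of DRSR arXiv:1402.7034,
Prop. 8.6.1 ("In the case `∞ ≥ r₃ ≥ R*_dec` …", `r_trap = 0`), needed here only for `r₃ = ∞`
because the finite `r₃` of `KerrTrappingRangeStructure.lean` is `≤ 6M < R_dec = 7M`.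
[cite: DafermosRodnianskiShlapentokhrothman2014, Prop. 8.6.1] -/
theorem trapping_estimate_inf (hMa : IsSubextremal M a) (hR : IsTortoiseRadius M a R)
    (hadm : IsAdmissibleTriple a ω m Λ) (hΛ1 : 1 ≤ Λ) (hbV : 0 < bV) (hδ₀ : 0 < δ₀)
    (hSinf : ∀ r, rPlus M a ≤ r → sepPotential M a ω m Λ r ≤ ω ^ 2 - bV * Λ)
    (hRb : 7 * M ≤ Rb) (hxb : R xb = Rb) (hρ : R (xb + 5) ≤ ρ)
    (hx : x₁ ≤ x₂) (hX₁ : rPlus M a + δ₀ ≤ R x₁) (hX₂ : R x₂ ≤ Rb)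
    (hD : ∀ t, |sharpBump₂ t| ≤ D)
    (hC : 2 * (208 / M ^ 3) / bV ≤ C) (hθ : 0 < θ) (hθB : θ * (208 / M ^ 3) ≤ 2 * bV)
    (hΛD : D / sharpBumpMass ≤ 7 / 10 * (C * bV * Λ))
    (hKω : ω ^ 2 ≤ Kω * Λ) (hKω0 : 0 ≤ Kω) (hE : 2 ≤ E)
    (hEbd : 2 * (1 - trapWeight C ρ θ (rPlus M a)) * (ω - horizonAngularVelocity M a * m) ^ 2 ≤
      E * (ω * (ω - horizonAngularVelocity M a * m)))
    (hu : ∀ x, HasDerivAt u (u₁ x) x) (hu₁ : ∀ x, HasDerivAt u₁ (u₂ x) x)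
    (hode : ∀ x, u₂ x + ((ω ^ 2 - sepPotential M a ω m Λ (R x) : ℝ) : ℂ) * u x = H x)
    (hH : Continuous H) (hS₁ : Integrable fun x ↦ ⟪H x, u₁ x⟫_ℝ)
    (hS₂ : Integrable fun x ↦ (H x * conj (u x)).im)
    (hb_top : Tendsto (fun x ↦ u₁ x - Complex.I * ω * u x) atTop (𝓝 0))
    (hb_bot : Tendsto (fun x ↦ u₁ x +
      Complex.I * ((ω - horizonAngularVelocity M a * m : ℝ) : ℂ) * u x) atBot (𝓝 0))
    (hA_top : Tendsto (fun x ↦ ‖u x‖ ^ 2) atTop (𝓝 Atop))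
    (hA_bot : Tendsto (fun x ↦ ‖u x‖ ^ 2) atBot (𝓝 Abot)) :
    C * (delta M a (rPlus M a + δ₀) / ((rPlus M a + δ₀) ^ 2 + a ^ 2)) *
          min 1 (bV / (4 * (Kω + 2))) *
        ∫ x in x₁..x₂, (‖u₁ x‖ ^ 2 + (ω ^ 2 + Λ + 1) * ‖u x‖ ^ 2) ≤
      ∫ x, combinedSource ω (ω - horizonAngularVelocity M a * m) E
        (trapMultipliers M a (xb + 2) 1 (1 / 2) (1 / 2) C ρ θ R) u u₁ H x := by
  /- ─────────────── constants ─────────────── -/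
  have hM := hMa.pos
  have haM : |a| ≤ M := le_of_lt hMa
  have hrpM : M ≤ rPlus M a := M_le_rPlus M a
  have hrp0 : 0 < rPlus M a := hM.trans_le hrpM
  have hΛ0 : 0 < Λ := one_pos.trans_le hΛ1
  obtain ⟨I, hIdef⟩ : ∃ I : ℝ, I = sharpBumpMass := ⟨_, rfl⟩
  rw [← hIdef] at hΛD
  have hI0 : 0 < I := by rw [hIdef]; exact sharpBumpMass_pos
  obtain ⟨B₁, hB₁⟩ : ∃ B₁ : ℝ, B₁ = 208 / M ^ 3 := ⟨_, rfl⟩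
  rw [← hB₁] at hC hθB
  have hB₁0 : 0 < B₁ := by rw [hB₁]; positivity
  have hC0 : 0 < C := lt_of_lt_of_le (by positivity) hC
  have hCB : 2 * B₁ ≤ C * bV := (div_le_iff₀ hbV).1 hC
  have hRb0 : 0 < Rb := by linarith
  -- `q`
  obtain ⟨q, hqdef⟩ : ∃ q : ℝ → ℝ, ∀ r, q r = delta M a r / (r ^ 2 + a ^ 2) := ⟨_, fun _ ↦ rfl⟩
  have hq_pos : ∀ r, rPlus M a < r → 0 < q r := fun r hr ↦ by
    rw [hqdef]; exact div_pos (Kerr.delta_pos haM hr) (by have := hrp0.trans hr; positivity)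
  have hq_mono : ∀ s r, rPlus M a ≤ s → s ≤ r → q s ≤ q r := fun s r hs hsr ↦ by
    rw [hqdef, hqdef]
    exact delta_div_mono hM.le (hrp0.trans_le hs) (haM.trans (hrpM.trans hs)) hsr
  have hqR_pos : ∀ x, 0 < q (R x) := fun x ↦ hq_pos _ (hR.rPlus_lt x)
  have hq7 : ∀ r, 7 * M ≤ r → 7 / 10 ≤ q r := fun r hr ↦ by
    rw [hqdef]; exact seven_tenths_le_delta_div hMa hr
  obtain ⟨qδ, hqδ⟩ : ∃ qδ : ℝ, qδ = q (rPlus M a + δ₀) := ⟨_, rfl⟩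
  have hqδ0 : 0 < qδ := by rw [hqδ]; exact hq_pos _ (by linarith)
  /- ─────────────── the potential ─────────────── -/
  obtain ⟨Vf, hVfdef⟩ : ∃ Vf : ℝ → ℝ, ∀ r, Vf r = sepPotential M a ω m Λ r := ⟨_, fun _ ↦ rfl⟩
  obtain ⟨Vr, hVrdef⟩ : ∃ Vr : ℝ → ℝ, ∀ r, Vr r = deriv (sepPotential M a ω m Λ) r :=
    ⟨_, fun _ ↦ rfl⟩
  have hSinf' : ∀ r, rPlus M a ≤ r → bV * Λ ≤ ω ^ 2 - Vf r := fun r hr ↦ by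
    rw [hVfdef]; have := hSinf r hr; linarith only [this]
  have hVneg7 : ∀ r, 7 * M ≤ r → Vr r < 0 := fun r hr ↦ by
    rw [hVrdef]; exact deriv_sepPotential_neg_of_seven_mul_le hMa hadm hr
  have hVr_abs : ∀ r, rPlus M a ≤ r → |Vr r| ≤ B₁ * Λ := fun r hr ↦ by
    have h := abs_deriv_sepPotential_le_of_one_le (ω := ω) (m := m) hM haM hadm hΛ1 hr
    rw [hVrdef, hB₁]; convert h using 1; ring
  clear hB₁
  /- ─────────────── geometry ─────────────── -/
  have hRgt : ∀ x, rPlus M a < R x := hR.rPlus_lt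
  have hRmono := (hR.strictMono hMa).monotone
  have hxb7 : ∀ x, xb ≤ x → 7 * M ≤ R x := fun x hx ↦ by
    have := hRmono hx; rw [hxb] at this; linarith only [this, hRb]
  /- ─────────────── the profiles ─────────────── -/
  obtain ⟨c, hcdef⟩ : ∃ c : ℝ, c = xb + 2 := ⟨_, rfl⟩
  rw [← hcdef]
  obtain ⟨fs, hfsdef⟩ : ∃ fs : ℝ → ℝ, ∀ x, fs x = (sharpMultipliers c 1 1 0).f x := ⟨_, fun _ ↦ rfl⟩
  obtain ⟨fs1, hfs1def⟩ : ∃ fs1 : ℝ → ℝ, ∀ x, fs1 x = (sharpMultipliers c 1 1 0).f' x :=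
    ⟨_, fun _ ↦ rfl⟩
  obtain ⟨fs3, hfs3def⟩ : ∃ fs3 : ℝ → ℝ, ∀ x, fs3 x = (sharpMultipliers c 1 1 0).f''' x :=
    ⟨_, fun _ ↦ rfl⟩
  have hf_abs : ∀ x, |fs x| ≤ 1 := fun x ↦ by
    rw [hfsdef]; exact sharpMultipliers_abs_f_le_one c 1 1 0 x
  have hf_negone : ∀ x, x ≤ c - 2 → fs x = -1 := fun x hx ↦ by
    rw [hfsdef]; exact sharpMultipliers_f_eq_neg_one (d := 1) (A := 0) one_pos (by linarith)
  have hf_one : ∀ x, c + 2 ≤ x → fs x = 1 := fun x hx ↦ by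
    rw [hfsdef]; exact sharpMultipliers_f_eq_one (d := 1) (A := 0) one_pos (by linarith)
  have hf'_nonneg : ∀ x, 0 ≤ fs1 x := fun x ↦ by
    rw [hfs1def]; exact sharpMultipliers_f'_nonneg (d := 1) (A := 0) one_pos x
  have hf'''_abs : ∀ x, |fs3 x| ≤ D / I := fun x ↦ by
    have h := sharpMultipliers_abs_f'''_le (c := c) (d := 1) (A := 0) (x := x) one_pos hD
    rw [hfs3def, hIdef]; simpa using h
  have hf'''_zero : ∀ x, 2 < |x - c| → fs3 x = 0 := fun x hx ↦ by
    rw [hfs3def]; exact sharpMultipliers_f'''_eq_zero_of_gt (d := 1) (A := 0) one_pos (by linarith)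
  clear hIdef
  /- ─────────────── the weight ─────────────── -/
  obtain ⟨Y, hYdef⟩ : ∃ Y : ℝ → ℝ, ∀ r, Y r = trapWeight C ρ θ r := ⟨_, fun _ ↦ rfl⟩
  obtain ⟨Y', hY'def⟩ : ∃ Y' : ℝ → ℝ, ∀ r, Y' r = trapWeightDeriv C ρ θ r := ⟨_, fun _ ↦ rfl⟩
  have hY_nonpos : ∀ r, Y r ≤ 0 := fun r ↦ by rw [hYdef]; exact trapWeight_nonpos hC0.le hθ ρ r
  have hY'_nonneg : ∀ r, 0 ≤ Y' r := fun r ↦ by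
    rw [hY'def]; exact trapWeightDeriv_nonneg hC0.le hθ ρ r
  have hY'_eq : ∀ r, r ≤ ρ → Y' r = C * (1 - Y r) := fun r hr ↦ by
    rw [hY'def, hYdef]; exact trapWeightDeriv_of_le hθ hr C
  have hY_zero : ∀ r, ρ + θ ≤ r → Y r = 0 := fun r hr ↦ by
    rw [hYdef]; exact trapWeight_of_ge hr hθ.le C
  have hY'_zero : ∀ r, ρ + θ ≤ r → Y' r = 0 := fun r hr ↦ by
    rw [hY'def]; exact trapWeightDeriv_of_ge hr hθ.le C
  have hY_tail : ∀ r, ρ ≤ r → r ≤ ρ + θ → |Y r| ≤ (ρ + θ - r) / 2 * Y' r := fun r h1 h2 ↦ by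
    rw [hYdef, hY'def]; exact abs_trapWeight_le_mul_deriv hC0.le hθ h1 h2
  /- ─────────────── the bulk, factorised ─────────────── -/
  obtain ⟨W, hW⟩ : ∃ W : ℝ → ℝ, ∀ x, W x =
      -((1 / 2 + 1 / 2 * fs x) * (Vr (R x) * q (R x))) - 1 / 2 * (1 / 2 * fs3 x) +
      Y' (R x) * q (R x) * (ω ^ 2 - Vf (R x)) - Y (R x) * (Vr (R x) * q (R x)) :=
    ⟨_, fun _ ↦ rfl⟩
  obtain ⟨P, hP⟩ : ∃ P : ℝ → ℝ, ∀ x, P x = 2 * (1 / 2 * fs1 x) + Y' (R x) * q (R x) :=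
    ⟨_, fun _ ↦ rfl⟩
  have hbulk : ∀ x, combinedBulk ω (ω - horizonAngularVelocity M a * m) E
      (fun x ↦ sepPotential M a ω m Λ (R x))
      (fun x ↦ deriv (sepPotential M a ω m Λ) (R x) * (delta M a (R x) / (R x ^ 2 + a ^ 2)))
      (trapMultipliers M a c 1 (1 / 2) (1 / 2) C ρ θ R) u u₁ x =
        P x * ‖u₁ x‖ ^ 2 + W x * ‖u x‖ ^ 2 := by
    intro x
    rw [combinedBulk_trapMultipliers, hP, hW, hfsdef, hfs1def, hfs3def, hYdef, hY'def, hVfdef,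
      hVrdef, hqdef, (trapMultipliers_f M a c 1 (1 / 2) (1 / 2) C ρ θ R x).1,
      (trapMultipliers_f M a c 1 (1 / 2) (1 / 2) C ρ θ R x).2.1,
      (trapMultipliers_f M a c 1 (1 / 2) (1 / 2) C ρ θ R x).2.2.2, trapMultipliers_y']
  have hP_ge : ∀ x, Y' (R x) * q (R x) ≤ P x := fun x ↦ by
    rw [hP]; have := hf'_nonneg x; linarith only [this]
  /- ─────────────── region A: `R x ≤ ρ` ─────────────── -/
  have hA : ∀ x, R x ≤ ρ → C * bV / 4 * q (R x) * Λ ≤ W x := by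
    intro x hx
    have hrp : rPlus M a ≤ R x := (hRgt x).le
    have hq0 := hqR_pos x
    obtain ⟨G, hG⟩ : ∃ G : ℝ, G = 1 - Y (R x) := ⟨_, rfl⟩
    have hYx := hY_nonpos (R x)
    have hG1 : 1 ≤ G := by rw [hG]; linarith only [hYx]
    have hYabs : |Y (R x)| ≤ G := by rw [abs_of_nonpos hYx, hG]; linarith only [hYx]
    have hY'r : Y' (R x) = C * G := by rw [hG]; exact hY'_eq (R x) hx
    have hV2 : bV * Λ ≤ ω ^ 2 - Vf (R x) := hSinf' (R x) hrp
    have hVr' : |Vr (R x)| ≤ B₁ * Λ := hVr_abs (R x) hrp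
    -- `−f V' ≥ 0`: `f = ½ + ½ f♯ ≥ 0`, and `f > 0` only where `R ≥ 7M` (`dV/dr < 0`)
    have t0 : 0 ≤ -((1 / 2 + 1 / 2 * fs x) * (Vr (R x) * q (R x))) := by
      rcases le_or_gt x (c - 2) with h | h
      · rw [hf_negone x h]; norm_num
      · have h7x : 7 * M ≤ R x := hxb7 x (by linarith only [h, hcdef])
        have hVn := hVneg7 (R x) h7x
        have hf0 : 0 ≤ 1 / 2 + 1 / 2 * fs x := by
          have := hf_abs x; rw [abs_le] at this; linarith only [this.1]
        have : (Vr (R x) * q (R x)) ≤ 0 := mul_nonpos_of_nonpos_of_nonneg hVn.le hq0.le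
        nlinarith only [hf0, this]
    have t1 : C * G * q (R x) * (bV * Λ) ≤ Y' (R x) * q (R x) * (ω ^ 2 - Vf (R x)) := by
      rw [hY'r]; exact mul_le_mul_of_nonneg_left hV2 (by positivity)
    have t3 : Y (R x) * (Vr (R x) * q (R x)) ≤ G * (B₁ * Λ) * q (R x) := by
      have h1 : |Y (R x) * (Vr (R x) * q (R x))| ≤ G * (B₁ * Λ * q (R x)) := by
        rw [abs_mul]
        refine mul_le_mul hYabs ?_ (abs_nonneg _) (by linarith only [hG1])
        rw [abs_mul, abs_of_pos hq0]
        exact mul_le_mul_of_nonneg_right hVr' hq0.le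
      have h2 := le_abs_self (Y (R x) * (Vr (R x) * q (R x)))
      have e : G * (B₁ * Λ * q (R x)) = G * (B₁ * Λ) * q (R x) := by ring
      linarith only [h1, h2, e]
    -- `¼|f♯'''|`: zero unless `|x − c| ≤ 2`, where `R ≥ 7M` and `q ≥ 7/10`
    have t4 : 1 / 2 * (1 / 2 * fs3 x) ≤ C * bV / 4 * q (R x) * Λ := by
      by_cases hz : fs3 x = 0
      · rw [hz, mul_zero, mul_zero]; positivity
      · have habs : |x - c| ≤ 2 := by
          by_contra h; push Not at h; exact hz (hf'''_zero x h)
        rw [abs_le] at habs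
        have h7x : 7 * M ≤ R x := hxb7 x (by linarith only [habs.1, hcdef])
        have hq7x : 7 / 10 ≤ q (R x) := hq7 (R x) h7x
        have h1 := hf'''_abs x
        have h2 : D / I ≤ 7 / 10 * (C * bV * Λ) := hΛD
        have h3 : C * bV * Λ * (7 / 10) ≤ C * bV * Λ * q (R x) :=
          mul_le_mul_of_nonneg_left hq7x (by positivity)
        linarith only [h1, h2, h3, le_abs_self (fs3 x)]
    have key : C * bV / 4 * q (R x) * Λ ≤
        C * G * q (R x) * (bV * Λ) - G * (B₁ * Λ) * q (R x) - C * bV / 4 * q (R x) * Λ := by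
      have hT : 0 ≤ q (R x) * Λ := by positivity
      have hCbV : 0 ≤ C * bV := by positivity
      have f0 : 0 ≤ C * bV * (q (R x) * Λ) := mul_nonneg hCbV hT
      have f1 : C * bV * (q (R x) * Λ) ≤ C * bV * G * (q (R x) * Λ) := by
        apply mul_le_mul_of_nonneg_right _ hT
        have := mul_le_mul_of_nonneg_left hG1 hCbV
        linarith only [this]
      have f3 : G * B₁ * (q (R x) * Λ) ≤ C * bV * G / 2 * (q (R x) * Λ) := by
        apply mul_le_mul_of_nonneg_right _ hT
        have hG0 : 0 ≤ G := by linarith only [hG1]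
        have := mul_le_mul_of_nonneg_right hCB hG0
        linarith only [this]
      linarith only [f0, f1, f3]
    rewrite [hW]
    linarith only [t0, t1, t3, t4, key]
  /- ─────────────── region B: `ρ < R x ≤ ρ + θ` ─────────────── -/
  have hρb : Rb ≤ ρ := by
    have := hRmono (show xb ≤ xb + 5 by linarith only); rw [hxb] at this
    exact this.trans hρ
  have hρ7 : 7 * M ≤ ρ := hRb.trans hρb
  have hxc3 : ∀ x, ρ < R x → c + 3 ≤ x := by
    intro x hx
    by_contra h; push Not at h
    have hle : x ≤ xb + 5 := by rw [hcdef] at h; linarith only [h]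
    have := hRmono hle
    linarith only [this, hρ, hx]
  have hBC : ∀ x, ρ < R x → q (R x) * (-Vr (R x)) ≤ W x := by
    intro x h1
    have hq0 := hqR_pos x
    have hx3 := hxc3 x h1
    have hf1 : fs x = 1 := hf_one x (by linarith only [hx3])
    have hxc' : 0 < x - c := by linarith only [hx3]
    have hf3 : fs3 x = 0 := hf'''_zero x (by rw [abs_of_pos hxc']; linarith only [hx3])
    have hVn : Vr (R x) < 0 := hVneg7 (R x) (by linarith only [hρ7, h1])
    -- the `Y`-terms: `Y'(ω² − V) q − Y (V_r q) ≥ 0`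
    have hYterms :
        0 ≤ Y' (R x) * q (R x) * (ω ^ 2 - Vf (R x)) - Y (R x) * (Vr (R x) * q (R x)) := by
      rcases le_or_gt (R x) (ρ + θ) with h2 | h2
      · -- the `C¹` tail: `|Y| ≤ ((ρ + θ − R)/2) Y'`, `θB₁ ≤ 2b_V`
        have hY' := hY'_nonneg (R x)
        have htail := hY_tail (R x) h1.le h2
        have hVr' : |Vr (R x)| ≤ B₁ * Λ := hVr_abs (R x) (hRgt x).le
        have hV2 : bV * Λ ≤ ω ^ 2 - Vf (R x) := hSinf' (R x) (hRgt x).le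
        have h3 : |Y (R x) * (Vr (R x) * q (R x))| ≤
            ((ρ + θ - R x) / 2 * Y' (R x)) * (B₁ * Λ * q (R x)) := by
          rw [abs_mul, abs_mul, abs_of_pos hq0]
          exact mul_le_mul htail (mul_le_mul_of_nonneg_right hVr' hq0.le) (by positivity)
            (by have : 0 ≤ ρ + θ - R x := by linarith only [h2]
                positivity)
        have h4 : (ρ + θ - R x) / 2 * Y' (R x) * (B₁ * Λ * q (R x)) ≤
            θ / 2 * Y' (R x) * (B₁ * Λ * q (R x)) := by
          have hle : (ρ + θ - R x) / 2 ≤ θ / 2 := by linarith only [h1]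
          have hnn : 0 ≤ Y' (R x) * (B₁ * Λ * q (R x)) := by positivity
          have := mul_le_mul_of_nonneg_right hle hnn
          linarith only [this]
        have h5 : θ / 2 * Y' (R x) * (B₁ * Λ * q (R x)) ≤ Y' (R x) * q (R x) * (bV * Λ) := by
          have hnn : 0 ≤ Y' (R x) * q (R x) * Λ := by positivity
          have := mul_le_mul_of_nonneg_right hθB hnn
          linarith only [this]
        have h6 : Y' (R x) * q (R x) * (bV * Λ) ≤ Y' (R x) * q (R x) * (ω ^ 2 - Vf (R x)) :=
          mul_le_mul_of_nonneg_left hV2 (by positivity)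
        linarith only [h3, h4, h5, h6, le_abs_self (Y (R x) * (Vr (R x) * q (R x)))]
      · rw [hY_zero (R x) h2.le, hY'_zero (R x) h2.le]; simp
    rewrite [hW, hf1, hf3]
    norm_num
    linarith only [hYterms]
  /- ─────────────── (i) and (ii) ─────────────── -/
  have hWnonneg : ∀ x, 0 ≤ W x := by
    intro x
    rcases le_or_gt (R x) ρ with h | h
    · exact le_trans (by have := hqR_pos x; positivity) (hA x h)
    · have hVn : Vr (R x) < 0 := hVneg7 (R x) (by linarith only [hρ7, h])
      have := hqR_pos x
      exact le_trans (mul_nonneg this.le (by linarith only [hVn])) (hBC x h)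
  have hPnonneg : ∀ x, 0 ≤ P x := fun x ↦
    le_trans (mul_nonneg (hY'_nonneg (R x)) (hqR_pos x).le) (hP_ge x)
  have hP0 : ∀ x, 0 ≤ combinedBulk ω (ω - horizonAngularVelocity M a * m) E
      (fun x ↦ sepPotential M a ω m Λ (R x))
      (fun x ↦ deriv (sepPotential M a ω m Λ) (R x) * (delta M a (R x) / (R x ^ 2 + a ^ 2)))
      (trapMultipliers M a c 1 (1 / 2) (1 / 2) C ρ θ R) u u₁ x := fun x ↦ by
    rw [hbulk]
    exact add_nonneg (mul_nonneg (hPnonneg x) (sq_nonneg _)) (mul_nonneg (hWnonneg x) (sq_nonneg _))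
  obtain ⟨β, hβ⟩ : ∃ β : ℝ, β = C * qδ * min 1 (bV / (4 * (Kω + 2))) := ⟨_, rfl⟩
  have hβ1 : β ≤ C * qδ := by
    rw [hβ]; have := min_le_left (1 : ℝ) (bV / (4 * (Kω + 2)))
    have h0 : 0 ≤ C * qδ := by positivity
    nlinarith only [this, h0]
  have hβ2 : β * (Kω + 2) ≤ C * bV / 4 * qδ := by
    rw [hβ]
    have h := min_le_right (1 : ℝ) (bV / (4 * (Kω + 2)))
    have hK : 0 < Kω + 2 := by linarith only [hKω0]
    have h0 : 0 ≤ C * qδ * (Kω + 2) := by positivity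
    have := mul_le_mul_of_nonneg_right h h0
    have e : bV / (4 * (Kω + 2)) * (C * qδ * (Kω + 2)) = C * bV / 4 * qδ := by
      field_simp
    nlinarith only [this, e]
  have hcoer : ∀ x ∈ Icc x₁ x₂, β * (‖u₁ x‖ ^ 2 + (ω ^ 2 + Λ + 1) * ‖u x‖ ^ 2) ≤
      combinedBulk ω (ω - horizonAngularVelocity M a * m) E
        (fun x ↦ sepPotential M a ω m Λ (R x))
        (fun x ↦ deriv (sepPotential M a ω m Λ) (R x) * (delta M a (R x) / (R x ^ 2 + a ^ 2)))
        (trapMultipliers M a c 1 (1 / 2) (1 / 2) C ρ θ R) u u₁ x := by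
    intro x hx
    have hRx : R x ≤ ρ := ((hRmono hx.2).trans hX₂).trans hρb
    have hq0 := hqR_pos x
    have hqx : qδ ≤ q (R x) := by
      rw [hqδ]
      refine hq_mono _ _ (by linarith only [hδ₀]) ?_
      exact hX₁.trans (hRmono hx.1)
    have hWx := hA x hRx
    -- `|u₁|²`: `P ≥ Y' q = C (1 − Y) q ≥ C q ≥ C q_δ ≥ β`
    have hPx : β ≤ P x := by
      have h1 := hP_ge x
      rw [hY'_eq (R x) hRx] at h1
      have hYx := hY_nonpos (R x)
      have h2 : C * q (R x) ≤ C * (1 - Y (R x)) * q (R x) := by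
        have : C * q (R x) * 1 ≤ C * q (R x) * (1 - Y (R x)) :=
          mul_le_mul_of_nonneg_left (by linarith only [hYx]) (by positivity)
        linarith only [this]
      have h3 : C * qδ ≤ C * q (R x) := mul_le_mul_of_nonneg_left hqx hC0.le
      linarith only [h1, h2, h3, hβ1]
    -- `|u|²`: `W ≥ (C b_V/4) q Λ ≥ β (K_ω + 2) Λ ≥ β (ω² + Λ + 1)`
    have hWβ : β * (ω ^ 2 + Λ + 1) ≤ W x := by
      have h1 : ω ^ 2 + Λ + 1 ≤ (Kω + 2) * Λ := by linarith only [hKω, hΛ1]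
      have hβ0 : 0 ≤ β := by rw [hβ]; positivity
      have h2 : β * (ω ^ 2 + Λ + 1) ≤ β * ((Kω + 2) * Λ) := mul_le_mul_of_nonneg_left h1 hβ0
      have h3 : β * ((Kω + 2) * Λ) ≤ C * bV / 4 * qδ * Λ := by
        have := mul_le_mul_of_nonneg_right hβ2 hΛ0.le
        linarith only [this]
      have h4 : C * bV / 4 * qδ * Λ ≤ C * bV / 4 * q (R x) * Λ := by
        apply mul_le_mul_of_nonneg_right _ hΛ0.le
        exact mul_le_mul_of_nonneg_left hqx (by positivity)
      linarith only [h2, h3, h4, hWx]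
    rw [hbulk]
    have e : β * (‖u₁ x‖ ^ 2 + (ω ^ 2 + Λ + 1) * ‖u x‖ ^ 2) =
        β * ‖u₁ x‖ ^ 2 + β * (ω ^ 2 + Λ + 1) * ‖u x‖ ^ 2 := by ring
    rw [e]
    exact add_le_add (mul_le_mul_of_nonneg_right hPx (sq_nonneg _))
      (mul_le_mul_of_nonneg_right hWβ (sq_nonneg _))
  /- ─────────────── assembly ─────────────── -/
  set ϖ : ℝ := ω - horizonAngularVelocity M a * m with hϖ
  set μ := trapMultipliers M a c 1 (1 / 2) (1 / 2) C ρ θ R with hμ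
  set V : ℝ → ℝ := fun x ↦ sepPotential M a ω m Λ (R x) with hVdef
  set V' : ℝ → ℝ := fun x ↦ deriv (sepPotential M a ω m Λ) (R x) *
    (delta M a (R x) / (R x ^ 2 + a ^ 2)) with hV'def
  have hV : ∀ x, HasDerivAt V (V' x) x := fun x ↦ hasDerivAt_sepPotential_comp hR hMa x
  have hμd : μ.HasDerivs := hasDerivs_trapMultipliers hR c 1 (1 / 2) (1 / 2) C ρ θ
  have hbdry : OutgoingBoundary ω ϖ V u u₁ Atop Abot :=
    { sub_top := hb_top
      add_bot := hb_bot
      normSq_top := hA_top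
      normSq_bot := hA_bot
      potential_top := tendsto_sepPotential_comp_atTop hR hMa hadm
      potential_bot := tendsto_sepPotential_comp_atBot hR hMa }
  have htop : μ.EndLimits atTop (1 / 2 + 1 / 2) 0 0 1 :=
    endLimits_trapMultipliers_atTop hR one_pos hθ.le c (1 / 2) (1 / 2) C ρ
  have hbot : μ.EndLimits atBot (1 / 2 - 1 / 2) (trapWeight C ρ θ (rPlus M a)) 0 1 :=
    endLimits_trapMultipliers_atBot hR one_pos c (1 / 2) (1 / 2) C ρ θ
  -- integrability of the source term
  have huc : Continuous u := continuous_iff_continuousAt.2 fun x ↦ (hu x).continuousAt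
  have hfc : Continuous μ.f := continuous_iff_continuousAt.2 fun x ↦ (hμd.df x).continuousAt
  have hf'c : Continuous μ.f' := continuous_iff_continuousAt.2 fun x ↦ (hμd.df' x).continuousAt
  have hyc : Continuous fun x ↦ trapWeight C ρ θ (R x) :=
    (continuous_trapWeight C ρ θ).comp hR.continuous
  have hSrc : Integrable (combinedSource ω ϖ E μ u u₁ H) := by
    have heq : combinedSource ω ϖ E μ u u₁ H = fun x ↦
        (-2 * μ.f x) * ⟪H x, u₁ x⟫_ℝ + -(μ.f' x * ⟪H x, u x⟫_ℝ) +
          (-2 * trapWeight C ρ θ (R x)) * ⟪H x, u₁ x⟫_ℝ + E * (ω * (H x * conj (u x)).im) := by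
      funext x
      rw [hμ, combinedSource_trapMultipliers]
      ring
    rw [heq]
    refine ((Integrable.add ?_ ?_).add ?_).add ?_
    · refine hS₁.bdd_mul (c := 2) (by fun_prop) (Eventually.of_forall fun x ↦ ?_)
      have h := hf_abs x
      have e : μ.f x = 1 / 2 + 1 / 2 * fs x := by
        rw [hμ, (trapMultipliers_f M a c 1 (1 / 2) (1 / 2) C ρ θ R x).1, hfsdef]
      have h1 : |(-2 : ℝ)| = 2 := by norm_num
      rw [Real.norm_eq_abs, abs_mul, e, h1]
      have h' := abs_le.1 h
      have h2 : |1 / 2 + 1 / 2 * fs x| ≤ 1 :=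
        abs_le.2 ⟨by linarith only [h'.1], by linarith only [h'.2]⟩
      linarith only [h2]
    · refine (Continuous.integrable_of_hasCompactSupport (hf'c.mul (hH.inner huc)) ?_).neg
      refine HasCompactSupport.intro (isCompact_Icc (a := c - 2) (b := c + 2)) fun x hx ↦ ?_
      have habs : 2 * (1 : ℝ) ≤ |x - c| := by
        rcases lt_or_ge x (c - 2) with h | h
        · rw [abs_of_neg (by linarith only [h])]; linarith only [h]
        · have : c + 2 < x := by
            by_contra h'; push Not at h'; exact hx ⟨h, h'⟩
          rw [abs_of_pos (by linarith only [this])]; linarith only [this]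
      have e : μ.f' x = 1 / 2 * (sharpMultipliers c 1 1 0).f' x := by
        rw [hμ, (trapMultipliers_f M a c 1 (1 / 2) (1 / 2) C ρ θ R x).2.1]
      change μ.f' x * ⟪H x, u x⟫_ℝ = 0
      rw [e, sharpMultipliers_f'_eq_zero (d := 1) (A := 0) one_pos habs, mul_zero, zero_mul]
    · obtain ⟨Γ, hΓ⟩ : ∃ Γ : ℝ, Γ = Real.exp (C * (ρ + θ / 2 - rPlus M a)) := ⟨_, rfl⟩
      refine hS₁.bdd_mul (c := 2 * Γ) (continuous_const.mul hyc).aestronglyMeasurable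
        (Eventually.of_forall fun x ↦ ?_)
      have hρp : rPlus M a ≤ ρ := by
        have := hRgt xb; rw [hxb] at this; linarith only [this, hρb]
      have h := one_sub_trapWeight_mem_Icc (C := C) (θ := θ) (r := R x) hC0.le hθ hρp
        (hR.rPlus_lt x).le
      have hY0 := trapWeight_nonpos hC0.le hθ ρ (R x)
      have h1 : |(-2 : ℝ)| = 2 := by norm_num
      have h2 : 1 - trapWeight C ρ θ (R x) ≤ Γ := by rw [hΓ]; exact h.2
      rw [Real.norm_eq_abs, abs_mul, h1, abs_of_nonpos hY0]
      linarith only [h2, h.1]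
    · exact (hS₂.const_mul ω).const_mul E
  have hw : Continuous fun _ : ℝ ↦ ω ^ 2 + Λ + 1 := continuous_const
  have hsign_top : 2 * ((1 / 2 + 1 / 2) + 0) * ω ^ 2 ≤ E * (1 * ω ^ 2 + 0 * ϖ * ω) := by
    have := mul_le_mul_of_nonneg_right hE (sq_nonneg ω)
    linarith only [this]
  have hsign_bot : 0 ≤ 2 * ((1 / 2 - 1 / 2) + trapWeight C ρ θ (rPlus M a)) * ϖ ^ 2 +
      E * (1 * ω * ϖ + 0 * ϖ ^ 2) := by
    have h0 : 0 ≤ ϖ ^ 2 := sq_nonneg ϖ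
    nlinarith only [hEbd, h0]
  have hβ' : C * (delta M a (rPlus M a + δ₀) / ((rPlus M a + δ₀) ^ 2 + a ^ 2)) *
      min 1 (bV / (4 * (Kω + 2))) = β := by rw [hβ, hqδ, hqdef]
  rw [hβ']
  exact combined_estimate_of_boundary_sign hV hμd hu hu₁ hode hH hSrc hbdry htop hbot hP0 hw hx
    hcoer hsign_top hsign_bot

end InfEstimate

/-! ### Prop. 8.6.1 over the range `𝓖_♮(ω_high, ε_width)` -/

section Final

/-- **Quantitative non-superradiance in `𝓖_♮`**: for a triple in `𝓖_♮(ω_high, ε)` (repaired strip,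
`M, a, α ≥ 0`, `ε > 0`), `(ω − ω₊m)² ≤ (1 + ω₊/√ε)² · ω(ω − ω₊m)`. If `mω ≤ 0`:
`ω(ω − ω₊m) ≥ ω²` and `|m| ≤ √Λ ≤ |ω|/√ε`; if `mω > 0`: off the strip `mω ≥ ω₊m²`, so
`(ω − ω₊m)² ≤ ω(ω − ω₊m)`. This is the quantitative form of "the non-superradiant condition
`mω ∉ (0, mω₊]` … ensure[s] that [the horizon] boundary term … [is] positive" for `E ≫ C` in the
proof of DRSR arXiv:1402.7034, Prop. 8.6.1 (cf. the footnote of §8.2 on `0 ≤ ω(ω − ω₊m) ≪ (ω − ω₊m)²`).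
[cite: DafermosRodnianskiShlapentokhrothman2014, Prop. 8.6.1 (proof)] -/
theorem sq_sub_le_mul_of_isFreqNatural' {M a α ε ωh ω Λ : ℝ} {m : ℤ} (hM : 0 ≤ M) (ha0 : 0 ≤ a)
    (hα : 0 ≤ α) (hε : 0 < ε) (hG : IsFreqNatural (IsNearSuperradiant' M a α) a ωh ε ω m Λ) :
    (ω - horizonAngularVelocity M a * m) ^ 2 ≤
      (1 + horizonAngularVelocity M a / √ε) ^ 2 * (ω * (ω - horizonAngularVelocity M a * m)) := by
  obtain ⟨hadm, -, hεΛ, -, hS⟩ := hG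
  set p := horizonAngularVelocity M a with hp
  have hp0 : 0 ≤ p := horizonAngularVelocity_nonneg hM ha0
  have hΛ := hadm.nonneg
  have hsε : 0 < √ε := Real.sqrt_pos.2 hε
  have hK0 : 0 ≤ p / √ε := div_nonneg hp0 hsε.le
  have hK1 : 1 ≤ (1 + p / √ε) ^ 2 := by nlinarith
  rcases le_or_gt ((m : ℝ) * ω) 0 with hnp | hpos
  · -- `mω ≤ 0`
    have hm2 : (m : ℝ) ^ 2 ≤ Λ := hadm.sq_le
    have hΛω : Λ ≤ ω ^ 2 / ε := by rw [le_div_iff₀ hε]; linarith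
    have hmω : |(m : ℝ)| ≤ |ω| / √ε := by
      refine abs_le_of_sq_le_sq ?_ (div_nonneg (abs_nonneg _) hsε.le)
      rw [div_pow, Real.sq_sqrt hε.le, sq_abs]; exact hm2.trans hΛω
    have h3 : (ω - p * m) ^ 2 ≤ (|ω| + p * |(m : ℝ)|) ^ 2 := by
      have e1 : |ω - p * m| ≤ |ω| + p * |(m : ℝ)| := by
        calc |ω - p * m| ≤ |ω| + |p * (m : ℝ)| := abs_sub _ _
          _ = |ω| + p * |(m : ℝ)| := by rw [abs_mul, abs_of_nonneg hp0]
      calc (ω - p * m) ^ 2 = |ω - p * m| ^ 2 := (sq_abs _).symm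
        _ ≤ (|ω| + p * |(m : ℝ)|) ^ 2 := pow_le_pow_left₀ (abs_nonneg _) e1 2
    have h4 : |ω| + p * |(m : ℝ)| ≤ |ω| * (1 + p / √ε) := by
      have := mul_le_mul_of_nonneg_left hmω hp0
      have e : |ω| * (1 + p / √ε) = |ω| + p * (|ω| / √ε) := by ring
      linarith
    have h5 : (|ω| + p * |(m : ℝ)|) ^ 2 ≤ (|ω| * (1 + p / √ε)) ^ 2 :=
      pow_le_pow_left₀ (by positivity) h4 2
    have h6 : (|ω| * (1 + p / √ε)) ^ 2 = (1 + p / √ε) ^ 2 * ω ^ 2 := by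
      rw [mul_pow, sq_abs]; ring
    have h7 : ω ^ 2 ≤ ω * (ω - p * m) := by nlinarith [mul_nonneg hp0 (neg_nonneg.2 hnp)]
    calc (ω - p * m) ^ 2 ≤ (1 + p / √ε) ^ 2 * ω ^ 2 := by linarith [h3, h5, h6]
      _ ≤ (1 + p / √ε) ^ 2 * (ω * (ω - p * m)) := mul_le_mul_of_nonneg_left h7 (by positivity)
  · -- `mω > 0`: off the strip, `mω ≥ ω₊m²`
    have hstrip : p * (m : ℝ) ^ 2 ≤ (m : ℝ) * ω := by
      by_contra h; push Not at h
      have hα' : 0 ≤ α * (|(m : ℝ)| * √Λ) := by positivity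
      exact hS ⟨hpos, by linarith⟩
    have hpm : 0 ≤ p * ((m : ℝ) * ω - p * (m : ℝ) ^ 2) := mul_nonneg hp0 (by linarith)
    have e : (ω - p * m) ^ 2 = ω * (ω - p * m) - p * ((m : ℝ) * ω - p * (m : ℝ) ^ 2) := by ring
    have h2 : (ω - p * m) ^ 2 ≤ ω * (ω - p * m) := by linarith
    have h1 : 0 ≤ ω * (ω - p * m) := (sq_nonneg _).trans h2
    calc (ω - p * m) ^ 2 ≤ ω * (ω - p * m) := h2
      _ = 1 * (ω * (ω - p * m)) := (one_mul _).symm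
      _ ≤ (1 + p / √ε) ^ 2 * (ω * (ω - p * m)) := mul_le_mul_of_nonneg_right hK1 h1

variable {M a α ε δ₀ Rb xb : ℝ} {R : ℝ → ℝ}

set_option maxHeartbeats 1600000 in
/-- **DRSR Prop. 8.6.1 (the estimate in the trapping range `𝓖_♮`), explicit form — proved.** Fix a
subextremal Kerr exterior (`0 < M`, `0 ≤ a < M`), a tortoise radius function `R`, the strip
parameter `α > 0`, `ε = ε_width > 0`, a margin `δ₀ > 0` and an outer radius `R_b ≥ 7M` with `R(x_b) = R_b`
(the region `[R*₋, R*₊]` of loc. cit.: below, any `[x₁, x₂]` with `R(x₁ − 1) ≥ r₊ + δ₀`,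
`R(x₂ + 1) ≤ R_b`). Then there are `ω₀`, `E`, `b > 0` such that for all `ω_high ≥ ω₀` ("`ω_high`,
`E` sufficiently big depending on `ε_width`") and every `(ω, m, Λ) ∈ 𝓖_♮(ω_high, ε)` (repaired
strip `IsNearSuperradiant' M a α`) there are a value `r_trap` — **either `r_trap = 0` or
`r₊ + b ≤ r_trap < 7M`** ("`r_trap = 0` or `0 < b < r_trap − r₊ < B`") — and explicit multipliers
`μ = trapMultipliers M a c L A₀ A₁ C ρ θ R` (`f = A₀ + A₁Φ((x − c)/L)/I`, `ŷ = Y_{C,ρ,θ} ∘ R`,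
`h = χ₁ = 0`, `χ₂ = 1`; `(A₀, A₁) = (0, 1)` with `R(c) = r_trap` in the trapped case, `(½, ½)` in
the case `r_trap = 0`) such that **for all `C²` solutions `u` of `u'' + (ω² − V(R))u = H` on `ℝ ∋ r*`
with the boundary conditions (eq:b±)**,
`b ∫_{x₁}^{x₂} (|u'|² + ((ω² + Λ)(1 − r⁻¹r_trap)² + 1)|u|²) dr*`
`  ≤ ∫ (−2f Re(u'H̄) − f' Re(uH̄) − 2ŷ Re(u'H̄) + Eω Im(Hū)) dr*`
— the estimate (thisisspartaEst) with its printed right-hand side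
(`KerrTrappingMultipliers.combinedSource_trapMultipliers`). Proof: Lemma 8.6.1 in the form
`KerrTrappingRangeStructure.exists_sepPotential_trapping_structure_of_isFreqNatural'`, then
`trapping_estimate_fin` (case `r₃ < ∞`, `r_trap = r_max`) or `trapping_estimate_inf` (case
`r₃ = ∞`), with `Λ ≥ εω²_high` large and `E` large by `sq_sub_le_mul_of_isFreqNatural'`. The
source's uniformity in `a ∈ [0, a₀]` and its specific `R*_∞`-behaviour of `f + ŷ` (Theorem 8.1) are not
transcribed; the dependence on the region (`δ₀`, `R_b`) is explicit instead of the fixed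
`[R*₋, R*₊]`; the printed uniform bounds "`|f| + Δ⁻¹r²|f'| + |ŷ| ≤ B(ε_width)`" hold for these
profiles by construction (`|f| ≤ 1`, `0 ≤ f' ≤ 1/(LI)` supported in `|r* − c| ≤ 2L`,
`1 ≤ 1 − ŷ ≤ e^{C(ρ + θ/2 − r₊)}`; `KerrSharpSupProfiles.lean`, `KerrTrappingMultipliers.lean`) and
are not restated. [cite: DafermosRodnianskiShlapentokhrothman2014, Prop. 8.6.1] -/
theorem trapping_estimate_of_isFreqNatural' (hM : 0 < M) (ha0 : 0 ≤ a) (haM : a < M)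
    (hR : IsTortoiseRadius M a R) (hα : 0 < α) (hε : 0 < ε) (hδ₀ : 0 < δ₀) (hRb : 7 * M ≤ Rb)
    (hxb : R xb = Rb) :
    ∃ ω₀ E b : ℝ, 0 < b ∧ ∀ ωh : ℝ, ω₀ ≤ ωh → ∀ (ω : ℝ) (m : ℤ) (Λ : ℝ),
      IsFreqNatural (IsNearSuperradiant' M a α) a ωh ε ω m Λ →
      ∃ (rtrap c L A₀ A₁ C ρ θ : ℝ), (rtrap = 0 ∨ (rPlus M a + b ≤ rtrap ∧ rtrap < 7 * M)) ∧
        0 < L ∧ 0 < C ∧ 0 < θ ∧ ((A₀ = 0 ∧ A₁ = 1 ∧ R c = rtrap) ∨ (A₀ = 1 / 2 ∧ A₁ = 1 / 2)) ∧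
        ∀ (u u₁ u₂ H : ℝ → ℂ) (Atop Abot x₁ x₂ : ℝ), x₁ ≤ x₂ → rPlus M a + δ₀ ≤ R (x₁ - 1) →
          R (x₂ + 1) ≤ Rb →
          (∀ x, HasDerivAt u (u₁ x) x) → (∀ x, HasDerivAt u₁ (u₂ x) x) →
          (∀ x, u₂ x + ((ω ^ 2 - sepPotential M a ω m Λ (R x) : ℝ) : ℂ) * u x = H x) →
          Continuous H → Integrable (fun x ↦ ⟪H x, u₁ x⟫_ℝ) →
          Integrable (fun x ↦ (H x * conj (u x)).im) →
          Tendsto (fun x ↦ u₁ x - Complex.I * ω * u x) atTop (𝓝 0) →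
          Tendsto (fun x ↦ u₁ x +
            Complex.I * ((ω - horizonAngularVelocity M a * m : ℝ) : ℂ) * u x) atBot (𝓝 0) →
          Tendsto (fun x ↦ ‖u x‖ ^ 2) atTop (𝓝 Atop) →
          Tendsto (fun x ↦ ‖u x‖ ^ 2) atBot (𝓝 Abot) →
          b * ∫ x in x₁..x₂, (‖u₁ x‖ ^ 2 + ((ω ^ 2 + Λ) * (1 - rtrap / R x) ^ 2 + 1) * ‖u x‖ ^ 2) ≤
            ∫ x, combinedSource ω (ω - horizonAngularVelocity M a * m) E
              (trapMultipliers M a c L A₀ A₁ C ρ θ R) u u₁ H x := by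
  have hMa : IsSubextremal M a := show |a| < M by rwa [abs_of_nonneg ha0]
  have haM' : |a| ≤ M := le_of_lt hMa
  have hrpM : M ≤ rPlus M a := M_le_rPlus M a
  have hrp0 : 0 < rPlus M a := hM.trans_le hrpM
  have hRb0 : 0 < Rb := by linarith
  -- Lemma 8.6.1
  obtain ⟨ω₀s, d, hd, bV, hbV, Bs, Hstr⟩ :=
    exists_sepPotential_trapping_structure_of_isFreqNatural' hM ha0 haM hα hε
  -- constants
  obtain ⟨D, hD0, hD⟩ := exists_bound_sharpBump₂
  obtain ⟨I, hIdef⟩ : ∃ I : ℝ, I = sharpBumpMass := ⟨_, rfl⟩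
  have hI0 : 0 < I := by rw [hIdef]; exact sharpBumpMass_pos
  obtain ⟨B₁, hB₁⟩ : ∃ B₁ : ℝ, B₁ = 208 / M ^ 3 := ⟨_, rfl⟩
  have hB₁0 : 0 < B₁ := by rw [hB₁]; positivity
  -- `q` at the relevant radii
  have hq_pos : ∀ r, rPlus M a < r → 0 < delta M a r / (r ^ 2 + a ^ 2) := fun r hr ↦
    div_pos (Kerr.delta_pos haM' hr) (by have := hrp0.trans hr; positivity)
  obtain ⟨q₁, hq₁⟩ : ∃ q₁ : ℝ,
      q₁ = delta M a (rPlus M a + min δ₀ d) / ((rPlus M a + min δ₀ d) ^ 2 + a ^ 2) := ⟨_, rfl⟩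
  have hq₁0 : 0 < q₁ := by rw [hq₁]; exact hq_pos _ (by have := lt_min hδ₀ hd; linarith)
  obtain ⟨qδ, hqδ⟩ : ∃ qδ : ℝ,
      qδ = delta M a (rPlus M a + δ₀) / ((rPlus M a + δ₀) ^ 2 + a ^ 2) := ⟨_, rfl⟩
  have hqδ0 : 0 < qδ := by rw [hqδ]; exact hq_pos _ (by linarith)
  -- parameters of the finite case
  obtain ⟨L, hL⟩ : ∃ L : ℝ, L = Rb / q₁ + 1 := ⟨_, rfl⟩
  have hL0 : 0 < L := by rw [hL]; have := div_nonneg hRb0.le hq₁0.le; linarith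
  obtain ⟨Cf, hCf⟩ : ∃ Cf : ℝ, Cf = max (4 * B₁ / bV) (4 / (L * I * Rb ^ 2)) := ⟨_, rfl⟩
  have hCf0 : 0 < Cf := by rw [hCf]; exact lt_max_of_lt_left (by positivity)
  obtain ⟨θf, hθf⟩ : ∃ θf : ℝ, θf = min (d / 2) (bV / (2 * B₁)) := ⟨_, rfl⟩
  have hθf0 : 0 < θf := by rw [hθf]; exact lt_min (by positivity) (by positivity)
  obtain ⟨qlow, hqlow⟩ : ∃ qlow : ℝ,
      qlow = delta M a (rPlus M a + 2 * d * Real.exp (-(2 * L) / M)) /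
        ((rPlus M a + 2 * d * Real.exp (-(2 * L) / M)) ^ 2 + a ^ 2) := ⟨_, rfl⟩
  have hqlow0 : 0 < qlow := by
    rw [hqlow]; exact hq_pos _ (by have := Real.exp_pos (-(2 * L) / M); nlinarith)
  -- parameters of the infinite case
  obtain ⟨Ci, hCi⟩ : ∃ Ci : ℝ, Ci = 2 * B₁ / bV := ⟨_, rfl⟩
  have hCi0 : 0 < Ci := by rw [hCi]; positivity
  obtain ⟨θi, hθi⟩ : ∃ θi : ℝ, θi = bV / B₁ := ⟨_, rfl⟩
  have hθi0 : 0 < θi := by rw [hθi]; positivity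
  obtain ⟨ρ, hρ⟩ : ∃ ρ : ℝ, ρ = R (xb + 5) := ⟨_, rfl⟩
  -- boundary constants
  obtain ⟨κ, hκ⟩ : ∃ κ : ℝ, κ = (1 + horizonAngularVelocity M a / √ε) ^ 2 := ⟨_, rfl⟩
  have hκ0 : 0 ≤ κ := by rw [hκ]; positivity
  obtain ⟨Γ, hΓ⟩ : ∃ Γ : ℝ,
      Γ = max (Real.exp (8 * M * Cf)) (Real.exp (Ci * (ρ + θi / 2 - rPlus M a))) := ⟨_, rfl⟩
  have hΓ0 : 0 ≤ Γ := by rw [hΓ]; exact le_max_of_le_left (Real.exp_pos _).le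
  obtain ⟨E, hEdef⟩ : ∃ E : ℝ, E = max 2 (2 * κ * Γ) := ⟨_, rfl⟩
  have hE2 : 2 ≤ E := by rw [hEdef]; exact le_max_left _ _
  -- the `Λ`-thresholds
  obtain ⟨Λ₁, hΛ₁⟩ : ∃ Λ₁ : ℝ, Λ₁ = D / (L ^ 3 * I) / (Cf * bV / 4 * qlow) := ⟨_, rfl⟩
  obtain ⟨Λ₂, hΛ₂⟩ : ∃ Λ₂ : ℝ,
      Λ₂ = D / (L ^ 3 * I) / (q₁ ^ 2 * bV * L / (I * (7 * M + 2 * L) ^ 4)) := ⟨_, rfl⟩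
  obtain ⟨Λ₃, hΛ₃⟩ : ∃ Λ₃ : ℝ, Λ₃ = D / I / (7 / 10 * (Ci * bV)) := ⟨_, rfl⟩
  obtain ⟨Λs, hΛs⟩ : ∃ Λs : ℝ, Λs = max 1 (max Λ₁ (max Λ₂ Λ₃)) := ⟨_, rfl⟩
  have hΛs1 : 1 ≤ Λs := by rw [hΛs]; exact le_max_left _ _
  have hΛs0 : 0 ≤ Λs := zero_le_one.trans hΛs1
  -- the final constants
  obtain ⟨βf, hβf⟩ : ∃ βf : ℝ, βf = min (2 / (L * I)) (q₁ ^ 3 * bV / (L * I * Rb ^ 4)) := ⟨_, rfl⟩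
  have hβf0 : 0 < βf := by rw [hβf]; exact lt_min (by positivity) (by positivity)
  obtain ⟨bf, hbf⟩ : ∃ bf : ℝ, bf = βf / (69 + (ε⁻¹ + 1) / M ^ 2) := ⟨_, rfl⟩
  have hbf0 : 0 < bf := by rw [hbf]; positivity
  obtain ⟨bi, hbi⟩ : ∃ bi : ℝ, bi = Ci * qδ * min 1 (bV / (4 * (ε⁻¹ + 2))) := ⟨_, rfl⟩
  have hbi0 : 0 < bi := by rw [hbi]; exact mul_pos (by positivity) (lt_min one_pos (by positivity))
  obtain ⟨b, hbdef⟩ : ∃ b : ℝ, b = min (min bf bi) d := ⟨_, rfl⟩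
  have hb0 : 0 < b := by rw [hbdef]; exact lt_min (lt_min hbf0 hbi0) hd
  have hbf' : b ≤ bf := by rw [hbdef]; exact (min_le_left _ _).trans (min_le_left _ _)
  have hbi' : b ≤ bi := by rw [hbdef]; exact (min_le_left _ _).trans (min_le_right _ _)
  have hbd : b ≤ d := by rw [hbdef]; exact min_le_right _ _
  refine ⟨max ω₀s (√(Λs / ε)), E, b, hb0, fun ωh hωh ω m Λ hG ↦ ?_⟩
  have hωhs : ω₀s ≤ ωh := (le_max_left _ _).trans hωh
  have hωhΛ : √(Λs / ε) ≤ ωh := (le_max_right _ _).trans hωh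
  -- unpack the range
  have hG' := hG
  obtain ⟨hadm, hωh', hεΛ, hω2, hS⟩ := hG'
  have hΛ : Λs ≤ Λ := by
    have h0 : 0 ≤ √(Λs / ε) := Real.sqrt_nonneg _
    have h1 : Λs / ε ≤ ωh ^ 2 := by
      calc Λs / ε = (√(Λs / ε)) ^ 2 := (Real.sq_sqrt (div_nonneg hΛs0 hε.le)).symm
        _ ≤ ωh ^ 2 := pow_le_pow_left₀ h0 hωhΛ 2
    have h2 : ωh ^ 2 ≤ ω ^ 2 := by
      calc ωh ^ 2 ≤ |ω| ^ 2 := pow_le_pow_left₀ (h0.trans hωhΛ) hωh' 2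
        _ = ω ^ 2 := sq_abs ω
    have h4 : ε * ω ^ 2 ≤ Λ := by
      have := mul_le_mul_of_nonneg_left hω2 hε.le
      rwa [← mul_assoc, mul_inv_cancel₀ hε.ne', one_mul] at this
    have h5 : Λs = ε * (Λs / ε) := by field_simp
    calc Λs = ε * (Λs / ε) := h5
      _ ≤ ε * ωh ^ 2 := mul_le_mul_of_nonneg_left h1 hε.le
      _ ≤ ε * ω ^ 2 := mul_le_mul_of_nonneg_left h2 hε.le
      _ ≤ Λ := h4
  have hΛ1 : 1 ≤ Λ := hΛs1.trans hΛ
  have hΛ0 : 0 < Λ := one_pos.trans_le hΛ1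
  have hΛ₁Λ : Λ₁ ≤ Λ := by
    refine le_trans ?_ hΛ; rw [hΛs]; exact (le_max_left _ _).trans (le_max_right _ _)
  have hΛ₂Λ : Λ₂ ≤ Λ := by
    refine le_trans ?_ hΛ; rw [hΛs]
    exact ((le_max_left _ _).trans (le_max_right _ _)).trans (le_max_right _ _)
  have hΛ₃Λ : Λ₃ ≤ Λ := by
    refine le_trans ?_ hΛ; rw [hΛs]
    exact ((le_max_right _ _).trans (le_max_right _ _)).trans (le_max_right _ _)
  have hKω : ω ^ 2 ≤ ε⁻¹ * Λ := hω2
  have hKω0 : 0 ≤ ε⁻¹ := by positivity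
  -- the boundary inequality, for any weight with `1 − Y(r₊) ≤ Γ`
  set ϖ := ω - horizonAngularVelocity M a * m with hϖ
  have hns : ϖ ^ 2 ≤ κ * (ω * ϖ) := by
    rw [hκ]; exact sq_sub_le_mul_of_isFreqNatural' hM.le ha0 hα.le hε hG
  have hωϖ : 0 ≤ ω * ϖ := by
    rcases eq_or_lt_of_le hκ0 with h | h
    · rw [← h, zero_mul] at hns
      have h0 : ϖ ^ 2 = 0 := le_antisymm hns (sq_nonneg ϖ)
      rw [pow_eq_zero_iff two_ne_zero] at h0
      rw [h0, mul_zero]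
    · exact nonneg_of_mul_nonneg_right ((sq_nonneg ϖ).trans hns) h
  have hEbd_of : ∀ G : ℝ, G ≤ Γ → 2 * G * ϖ ^ 2 ≤ E * (ω * ϖ) := by
    intro G hG
    have h1 : 2 * G * ϖ ^ 2 ≤ 2 * Γ * ϖ ^ 2 :=
      mul_le_mul_of_nonneg_right (by linarith) (sq_nonneg ϖ)
    have h2 : 2 * Γ * ϖ ^ 2 ≤ 2 * Γ * (κ * (ω * ϖ)) := mul_le_mul_of_nonneg_left hns (by positivity)
    have h3 : 2 * κ * Γ ≤ E := by rw [hEdef]; exact le_max_right _ _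
    have h4 : 2 * Γ * (κ * (ω * ϖ)) ≤ E * (ω * ϖ) := by
      have := mul_le_mul_of_nonneg_right h3 hωϖ; linarith only [this]
    linarith only [h1, h2, h4]
  -- the dichotomy of Lemma 8.6.1
  rcases Hstr ωh hωhs ω m Λ hG with hinf |
    ⟨r₃, rmax, hr₃, hr₃6, hgap, h7, hS2, hS3a, hS3z, hS3b, hmax, hS4, hnondeg, -⟩
  · /- ────── the case `r₃ = ∞`: `r_trap = 0` ────── -/
    refine ⟨0, xb + 2, 1, 1 / 2, 1 / 2, Ci, ρ, θi, Or.inl rfl, one_pos, hCi0, hθi0,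
      Or.inr ⟨rfl, rfl⟩, ?_⟩
    intro u u₁ u₂ H Atop Abot x₁ x₂ hx hX₁ hX₂ hu hu₁ hode hH hS₁ hS₂ hb_top hb_bot hA_top hA_bot
    have hmono := (hR.strictMono hMa).monotone
    have hX₁' : rPlus M a + δ₀ ≤ R x₁ := hX₁.trans (hmono (by linarith))
    have hX₂' : R x₂ ≤ Rb := (hmono (by linarith)).trans hX₂
    have hSinf : ∀ r, rPlus M a ≤ r → sepPotential M a ω m Λ r ≤ ω ^ 2 - bV * Λ :=
      fun r hr ↦ hinf r hr
    have hC : 2 * (208 / M ^ 3) / bV ≤ Ci := by rw [hCi, hB₁]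
    have hθB : θi * (208 / M ^ 3) ≤ 2 * bV := by
      rw [hθi, ← hB₁, div_mul_cancel₀ bV hB₁0.ne']; linarith
    have hΛD : D / sharpBumpMass ≤ 7 / 10 * (Ci * bV * Λ) := by
      rw [← hIdef]
      have hden : 0 < 7 / 10 * (Ci * bV) := by positivity
      have := (div_le_iff₀ hden).1 (hΛ₃ ▸ hΛ₃Λ)
      have e : Λ * (7 / 10 * (Ci * bV)) = 7 / 10 * (Ci * bV * Λ) := by ring
      exact this.trans_eq e
    have hEbd : 2 * (1 - trapWeight Ci ρ θi (rPlus M a)) * ϖ ^ 2 ≤ E * (ω * ϖ) := by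
      refine hEbd_of _ ?_
      have hρp : rPlus M a ≤ ρ := by rw [hρ]; exact (hR.rPlus_lt _).le
      have h := one_sub_trapWeight_mem_Icc (C := Ci) (θ := θi) (r := rPlus M a) hCi0.le hθi0 hρp
        le_rfl
      rw [hΓ]; exact h.2.trans (le_max_right _ _)
    have hest := trapping_estimate_inf (E := E) hMa hR hadm hΛ1 hbV hδ₀ hSinf hRb hxb (hρ ▸ le_rfl)
      hx hX₁' hX₂' hD hC hθi0 hθB hΛD hKω hKω0 hE2 hEbd hu hu₁ hode hH hS₁ hS₂ hb_top hb_bot hA_top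
      hA_bot
    -- the weight with `r_trap = 0`
    have hI : ∫ x in x₁..x₂, (‖u₁ x‖ ^ 2 + ((ω ^ 2 + Λ) * (1 - 0 / R x) ^ 2 + 1) * ‖u x‖ ^ 2) =
        ∫ x in x₁..x₂, (‖u₁ x‖ ^ 2 + (ω ^ 2 + Λ + 1) * ‖u x‖ ^ 2) :=
      intervalIntegral.integral_congr fun x _ ↦ by simp
    rw [hI]
    have hnn : 0 ≤ ∫ x in x₁..x₂, (‖u₁ x‖ ^ 2 + (ω ^ 2 + Λ + 1) * ‖u x‖ ^ 2) :=
      intervalIntegral.integral_nonneg hx fun x _ ↦ by positivity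
    have hbbi : b ≤ Ci * qδ * min 1 (bV / (4 * (ε⁻¹ + 2))) := by rw [← hbi]; exact hbi'
    rw [hqδ] at hbbi
    exact (mul_le_mul_of_nonneg_right hbbi hnn).trans hest
  · /- ────── the case `r₃ < ∞`: `r_trap = r_max` ────── -/
    obtain ⟨c, hc⟩ := hR.exists_eq hMa (show rPlus M a < rmax by linarith)
    refine ⟨rmax, c, L, 0, 1, Cf, r₃, θf, Or.inr ⟨by linarith, h7⟩, hL0, hCf0, hθf0,
      Or.inl ⟨rfl, rfl, hc⟩, ?_⟩
    intro u u₁ u₂ H Atop Abot x₁ x₂ hx hX₁ hX₂ hu hu₁ hode hH hS₁ hS₂ hb_top hb_bot hA_top hA_bot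
    have hC : 4 * (208 / M ^ 3) / bV ≤ Cf := by rw [hCf, hB₁]; exact le_max_left _ _
    have hC' : 4 / (L * sharpBumpMass * Rb ^ 2) ≤ Cf := by
      rw [hCf, ← hIdef]; exact le_max_right _ _
    have hθd : θf ≤ d / 2 := by rw [hθf]; exact min_le_left _ _
    have hθB : θf * (208 / M ^ 3) ≤ bV / 2 := by
      have h : θf ≤ bV / (2 * B₁) := by rw [hθf]; exact min_le_right _ _
      rw [← hB₁]
      rw [le_div_iff₀ (by positivity)] at h
      linarith
    have hΛA : D / (L ^ 3 * sharpBumpMass) ≤ Cf * bV / 4 * qlow * Λ := by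
      rw [← hIdef]
      have hden : 0 < Cf * bV / 4 * qlow := by positivity
      have := (div_le_iff₀ hden).1 (hΛ₁ ▸ hΛ₁Λ)
      have e : Λ * (Cf * bV / 4 * qlow) = Cf * bV / 4 * qlow * Λ := by ring
      exact this.trans_eq e
    have hΛC : D / (L ^ 3 * sharpBumpMass) ≤
        q₁ ^ 2 * bV * L * Λ / (sharpBumpMass * (7 * M + 2 * L) ^ 4) := by
      rw [← hIdef]
      have hden : 0 < q₁ ^ 2 * bV * L / (I * (7 * M + 2 * L) ^ 4) := by positivity
      have := (div_le_iff₀ hden).1 (hΛ₂ ▸ hΛ₂Λ)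
      have e : Λ * (q₁ ^ 2 * bV * L / (I * (7 * M + 2 * L) ^ 4)) =
          q₁ ^ 2 * bV * L * Λ / (I * (7 * M + 2 * L) ^ 4) := by ring
      exact this.trans_eq e
    have hEbd : 2 * (1 - trapWeight Cf r₃ θf (rPlus M a)) * ϖ ^ 2 ≤ E * (ω * ϖ) := by
      refine hEbd_of _ ?_
      have hr₃p : rPlus M a ≤ r₃ := by linarith
      have h := one_sub_trapWeight_mem_Icc (C := Cf) (θ := θf) (r := rPlus M a) hCf0.le hθf0 hr₃p
        le_rfl
      have h2 : Real.exp (Cf * (r₃ + θf / 2 - rPlus M a)) ≤ Real.exp (8 * M * Cf) := by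
        rw [Real.exp_le_exp]
        have : r₃ + θf / 2 - rPlus M a ≤ 8 * M := by
          have hd6 : d ≤ 6 * M := by linarith
          linarith
        calc Cf * (r₃ + θf / 2 - rPlus M a) ≤ Cf * (8 * M) := mul_le_mul_of_nonneg_left this hCf0.le
          _ = 8 * M * Cf := by ring
      rw [hΓ]; exact (h.2.trans h2).trans (le_max_left _ _)
    have hest := trapping_estimate_fin (E := E) hMa hR hadm hΛ1 hbV hd hδ₀ hr₃ hgap h7
      (fun r hr ↦ hS2 r hr) hS3a hS3b hS4 hc hRb hx hX₁ hX₂ hq₁ hqlow hD (by rw [hL]) hC hC' hθf0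
      hθd hθB hΛA hΛC hKω hKω0 hE2 hEbd hu hu₁ hode hH hS₁ hS₂ hb_top hb_bot hA_top hA_bot
    have hnn : 0 ≤ ∫ x in x₁..x₂,
        (‖u₁ x‖ ^ 2 + ((ω ^ 2 + Λ) * (1 - rmax / R x) ^ 2 + 1) * ‖u x‖ ^ 2) :=
      intervalIntegral.integral_nonneg hx fun x _ ↦ by positivity
    have hbbf : b ≤ min (2 / (L * sharpBumpMass)) (q₁ ^ 3 * bV / (L * sharpBumpMass * Rb ^ 4)) /
        (69 + (ε⁻¹ + 1) / M ^ 2) := by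
      rw [← hIdef, ← hβf, ← hbf]; exact hbf'
    exact (mul_le_mul_of_nonneg_right hbbf hnn).trans hest

end Final

end Kerr

end Literature.Geometry.Lorentzian

end
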